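import Literature.Computability.Complexity.StackFFTOverlapAdd
import Literature.Computability.Complexity.NegacyclicFFTPlan
import Literature.Computability.Complexity.StackFFTDriverSlots
import HarnessLib

/-!
# The recursion driver of the fast negacyclic multiplier, I: the steps

Literature / complexity toolkit, continuing `StackFFTOverlapAdd.lean` (the batch passes),
`NegacyclicFFTPlan.lean` (the list-level plan) and `StackFFTDriverSlots.lean` (the register
file).  The breadth-first Schönhage–Strassen / Cantor–Kaltofen multiplier runs `negMulRec`
(`NegacyclicFFT.lean`) on a batch of pairs of blocks of length `2^k` as: DESCENTS while `k > 3`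
(schedule `k`, compute the parameters `a = ⌈k/2⌉, lv = ⌊k/2⌋, m = 2^a, t = 2^{lv}`, digitize both
batches, run the `lv` forward levels saving each level's parent twiddles on the history `HIST`,
`k := a + 1`), the schoolbook products of the leaves, ASCENTS along the schedule (pop `k`,
parameters, the `lv` inverse levels popping the twiddles, overlap-add).  This file verifies the
straight-line pieces and the two counted level loops, each as a `Runs` lemma between explicit
driver records (`GSlots.withParams / descAt / descEnd / ascAt / ascEnd`):

* utilities `pow2Into` (`2^a` as a numeral), `prependItem` (push an item on a stack of items),
  the ambient invariant `DrvInv`, wrappers of the batch passes over the driver's file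
  (`digitBF`, `digitBG`, `lvlBF`, `lvlBG`, `lvlRR`, `baseStep`, `oaRR`) with their run lemmas;
* `setParams` / **`runs_setParams`**; the descent step `descA`, `lvBody` (**`runs_lvBody`**:
  level `j ↦ j+1` is `NegFFT.levelOut_dLevel`), `descC`, **`runs_descStep`** (result
  `NegFFT.descOne` on both batches, history `NegFFT.twHist`); the leaves `baseAll` /
  **`runs_baseAll`**; the ascent step `ascA`, `ascBody` (**`runs_ascBody`**: merge height
  `r ↦ r+1` is `NegFFT.levelOut_aLevel`), `ascC` (overlap-add of `NegFFT.aChunks`),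
  **`runs_ascStep`** (result `NegFFT.ascOne`);
* costs: every piece is linear in the data size times `(n+1)³` (`lvlBound`, `levelCost_le`,
  `lvlCost_le`, `descStepCost`, `ascStepCost`, …).

## References

* J. von zur Gathen, J. Gerhard, *Modern Computer Algebra*, 3rd ed., CUP 2013, §8.3 Alg. 8.20.
* D. G. Cantor, E. Kaltofen, On fast multiplication of polynomials over arbitrary algebras,
  *Acta Inform.* 28 (1991) 693–701.
* A. Schönhage, V. Strassen, Schnelle Multiplikation großer Zahlen, *Computing* 7 (1971)
  281–292. (Folklore material, fully proved here.)
-/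

namespace Literature.Computability.Complexity

open _root_.Computability SProg

namespace Com

variable {β : Type} [DecidableEq β] (q : GReg ↪ β)

/-! ### Small utilities of the driver -/

/-- `dst := 2^a` as a numeral, from `a` in `src` (unary count on the vector-pass register `U`):
push the leading `1`, then `a` zeros. [folklore] -/
def pow2Into (dst src : β) : Com (EReg ⊕ β) :=
  push (Sum.inr dst) true ;; (nToUnary (rVG q .U) src ;; countLoop (Sum.inr (rVG q .U)) (push (Sum.inr dst) false))

/-- **`pow2Into`.** [folklore] -/
theorem runs_pow2Into {dst src : β} (hdU : dst ≠ q (.f (.n (.v .U)))) (hds : dst ≠ src) {a n : ℕ}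
    (han : (encodeNat a).length ≤ n) (T : Regs β) (hsrc : T src = encodeNat a) (hdst : T dst = []) (hU : T (q (.f (.n (.v .U)))) = []) :
    Runs (pow2Into q dst src) (base T) (base (Function.update T dst (encodeNat (2 ^ a)))) (n * (16 * a + 21) + 3 * a + 7) := by
  have hsU : src ≠ q (.f (.n (.v .U))) ∨ a = 0 := by
    by_cases h : src = q (.f (.n (.v .U)))
    · right; rw [h, hU] at hsrc
      have := congrArg bitsToNat hsrc; rw [bitsToNat_encodeNat] at this; simpa [bitsToNat] using this.symm
    · left; exact h
  -- files along the way: `dst` holds `0^{a-k} 1`, `U` holds `1^k`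
  let Tk : ℕ → Regs β := fun k => Function.update (Function.update T dst (List.replicate (a - k) false ++ [true])) (q (.f (.n (.v .U)))) (List.replicate k true)
  have h1 : Runs (push (Sum.inr dst) true : Com (EReg ⊕ β)) (base T) (base (Function.update T dst [true])) 1 :=
    (Runs.push _ _ _).of_eq (by simp [hdst]) le_rfl
  have h2 : Runs (nToUnary (rVG q .U) src) (base (Function.update T dst [true])) (base (Tk a)) (n * (16 * a + 21) + 5) := by
    have hsrc' : Function.update T dst [true] src = encodeNat a := by rw [Function.update_of_ne hds.symm, hsrc]
    refine (runs_nToUnary (rVG q .U) src (Function.update T dst [true]) (by simp [hdU.symm, hU])).of_eq ?_ ?_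
    · simp only [rVG_apply, hsrc', bitsToNat_encodeNat, Tk, Nat.sub_self, List.replicate_zero, List.nil_append]
    · simp only [hsrc', bitsToNat_encodeNat]
      exact Nat.add_le_add_right (Nat.mul_le_mul_right _ han) _
  have h3 := runs_countLoop (U := (Sum.inr (q (.f (.n (.v .U)))) : EReg ⊕ β)) (body := push (Sum.inr dst) false)
    (fun k R => k ≤ a ∧ R = base (Tk k)) 1
    (by
      rintro k R ⟨hka, rfl⟩ -
      have e1 : Function.update (base (Tk (k + 1))) (Sum.inr (q (.f (.n (.v .U))))) (List.replicate k true) =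
          base (Function.update (Function.update T dst (List.replicate (a - (k + 1)) false ++ [true])) (q (.f (.n (.v .U)))) (List.replicate k true)) := by
        simp [Tk]
      rw [e1]
      refine ⟨base (Tk k), (Runs.push _ _ _).of_eq ?_ le_rfl, by simp [Tk], by omega, rfl⟩
      simp only [Tk, update_nst_inr, nst_inr, Function.update_of_ne hdU, Function.update_self]
      rw [Function.update_comm hdU, Function.update_idem, ← List.cons_append, ← List.replicate_succ,
        show a - (k + 1) + 1 = a - k by omega, Function.update_comm (Ne.symm hdU)])
    a (base (Tk a)) ⟨le_rfl, rfl⟩ (by simp [Tk])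
  obtain ⟨R', hR, -, -, rfl⟩ := h3
  refine (h1.seq (h2.seq hR)).of_eq ?_ (by omega)
  simp only [Tk, Nat.sub_zero, List.replicate_zero, encodeNat_two_pow]
  congr 1
  exact Function.update_eq_self_iff.2 (by rw [Function.update_of_ne (Ne.symm hdU), hU])

/-- Prepend the contents of `src` as a forward item onto the stack `dst` (through `TMPH`):
`dst := dbl v ++ [ff, tt] ++ dst`, `src := []`. [folklore] -/
def prependItem (src dst : β) : Com (EReg ⊕ β) :=
  emit (Sum.inr src) (Sum.inr (q .TMPH)) ;; pour (Sum.inr (q .TMPH)) (Sum.inr dst)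

/-- **`prependItem`.** [folklore] -/
theorem runs_prependItem {src dst : β} (hs : src ≠ q .TMPH) (hd : dst ≠ q .TMPH) (hsd : src ≠ dst) (T : Regs β) (hT : T (q .TMPH) = []) :
    Runs (prependItem q src dst) (base T)
      (base (Function.update (Function.update T src []) dst (dbl (T src) ++ [false, true] ++ T dst))) (10 * (T src).length + 10) := by
  have h1 : Runs (emit (Sum.inr src) (Sum.inr (q .TMPH))) (base T)
      (base (Function.update (Function.update T src []) (q .TMPH) (true :: false :: ((dbl (T src)).reverse ++ T (q .TMPH))))) (4 * (T src).length + 3) :=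
    (runs_emit (h := (Sum.inr src : EReg ⊕ β)) (o := Sum.inr (q .TMPH)) (by simpa using hs) (base T)).of_eq (by simp [dbl]) (by simp)
  have h2 := runs_opour (a := q .TMPH) (b := dst) hd.symm (Function.update (Function.update T src []) (q .TMPH)
    (true :: false :: ((dbl (T src)).reverse ++ T (q .TMPH))))
  refine (h1.seq h2).of_eq ?_ ?_
  · simp only [hT, List.append_nil]
    congr 1
    funext y
    simp only [Function.update_apply]
    by_cases h1 : y = dst <;> by_cases h2 : y = q .TMPH <;> by_cases h3 : y = src <;> simp_all
  · simp only [Function.update_self, List.length_cons, List.length_append, List.length_reverse, length_dbl, hT, List.length_nil]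
    omega

/-- Run the digitize pass on the batch `BF`: move it into `IN`, run, move `OUT` back to `BF` and the
root twiddles from `TWOUT` into `TW`. [folklore] -/
def digitBF : Com (EReg ⊕ β) :=
  move (Sum.inr (q .BF)) (Sum.inr (rFG q .IN)) (ra .s) ;; (digitizePass (rFG q) ;;
  (move (Sum.inr (rFG q .OUT)) (Sum.inr (q .BF)) (ra .s) ;; move (Sum.inr (rFG q .TWOUT)) (Sum.inr (rFG q .TW)) (ra .s)))

/-- Run the digitize pass on the batch `BG`; its root twiddles go into `TW2`. [folklore] -/
def digitBG : Com (EReg ⊕ β) :=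
  move (Sum.inr (q .BG)) (Sum.inr (rFG q .IN)) (ra .s) ;; (digitizePass (rFG q) ;;
  (move (Sum.inr (rFG q .OUT)) (Sum.inr (q .BG)) (ra .s) ;; move (Sum.inr (rFG q .TWOUT)) (Sum.inr (q .TW2)) (ra .s)))

/-- The ambient invariant of the driver: modulus and clean vector-pass / multiplier scratch in the
ambient file (everything the driver changes lives in `GSlots`; the ambient values under the
level-pass slots `L1 L2 DST` are required clean only to state the multiplier's invariant).
[folklore] -/
def DrvInv (N : ℕ) (T : Regs β) : Prop :=
  T (q (.f (.n (.v .MD)))) = encodeNat N ∧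
  T (q (.f (.n (.v .A)))) = [] ∧ T (q (.f (.n (.v .B)))) = [] ∧ T (q (.f (.n (.v .D)))) = [] ∧ T (q (.f (.n (.v .F)))) = [] ∧
  T (q (.f (.n (.v .G)))) = [] ∧ T (q (.f (.n (.v .W)))) = [] ∧ T (q (.f (.n (.v .TT)))) = [] ∧ T (q (.f (.n (.v .O)))) = [] ∧
  T (q (.f (.n (.v .S)))) = [] ∧ T (q (.f (.n (.v .U)))) = [] ∧
  T (q (.f (.n .FP))) = [] ∧ T (q (.f (.n .GP))) = [] ∧ T (q (.f (.n .ACC))) = [] ∧ T (q .TMPH) = [] ∧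
  T (q (.f (.n (.v .L1)))) = [] ∧ T (q (.f (.n (.v .L2)))) = [] ∧ T (q (.f (.n (.v .DST)))) = []

/-- Cost of `digitBF` / `digitBG` on `B` blocks of length `mt`. [folklore] -/
def digitCost (n m t B : ℕ) : ℕ := digitizeCost n m t B + 72 * (B * (m * t) * (2 * n)) + 12 * B * t + 24 * B * (2 * n) + 24 * B + 10

/-- **`digitBF`.** [folklore] -/
theorem runs_digitBF {N n m t : ℕ} (hn : (encodeNat N).length + 1 ≤ n) (hmn : (encodeNat m).length ≤ n)
    (hm2n : (encodeNat (2 * m)).length + 1 ≤ n) (htn : (encodeNat t).length ≤ n) (T : Regs β) (hI : DrvInv q N T)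
    (w : GSlots) {Fb : List (List ℕ)} (hFb : ∀ b ∈ Fb, (∀ a ∈ b, a < N) ∧ b.length = m * t)
    (hbf : w.bf = encBlocks Fb) (hhn : w.hn = encodeNat m) (hm2 : w.m2 = encodeNat (2 * m)) (hout : w.out = []) (htwout : w.twout = [])
    (hold hold2 tmp e l1 l2 dst : List Bool) (hfz : w.fz = ⟨[], hold, hold2, tmp, [], [], encodeNat t, [], [], [], [], [], e, l1, l2, dst⟩) :
    Runs (digitBF q) (base (gSt q T w))
      (base (gSt q T { w with bf := encBlocks (Fb.flatMap (chunksPad m t)), fz := ⟨[], hold, hold2, tmp, encVec (List.replicate Fb.length (2 * m)), [], encodeNat t, [], [], [], [], [], e, l1, l2, dst⟩ }))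
      (digitCost n m t Fb.length) := by
  obtain ⟨-, -, -, -, -, -, hW, hTT, -, -, hU, -, -, -, -, -, -, -⟩ := hI
  have hgq : ∀ {i j : GReg}, i ≠ j → q i ≠ q j := fun h => gq_ne q h
  set B := Fb.length with hB
  -- lengths
  have hlin : (encBlocks Fb).length ≤ B * (2 * (m * t * (2 * n)) + 2) := by
    unfold encBlocks; rw [length_encList, List.map_map]
    have : ∀ x ∈ Fb.map ((fun a : List Bool => 2 * a.length + 2) ∘ encVec), x ≤ 2 * (m * t * (2 * n)) + 2 := by
      intro x hx; rw [List.mem_map] at hx; obtain ⟨u, hu, rfl⟩ := hx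
      have h1 := length_encVec_le_of_lt (hFb u hu).1 hn; rw [(hFb u hu).2] at h1; simp only [Function.comp_apply]; omega
    have hs := List.sum_le_card_nsmul _ _ this
    rwa [List.length_map, smul_eq_mul] at hs
  have hov : ∀ c ∈ Fb.flatMap (chunksPad m t), c.length = 2 * m ∧ ∀ a ∈ c, a < N := by
    intro c hc; rw [List.mem_flatMap] at hc; obtain ⟨b, hb, hc⟩ := hc
    exact (chunksPad_valid m t b (hFb b hb).1 (hFb b hb).2).2 c hc
  have hlout' : (Fb.flatMap (chunksPad m t)).length = B * t := by
    rw [List.length_flatMap, List.map_congr_left (fun b hb => (chunksPad_valid m t b (hFb b hb).1 (hFb b hb).2).1), List.map_const',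
      List.sum_replicate, smul_eq_mul]
  have hlout : (encBlocks (Fb.flatMap (chunksPad m t))).length ≤ B * t * (2 * (2 * m * (2 * n)) + 2) := by
    have := length_encBlocks_le (m := m) hn hov; rwa [hlout'] at this
  have hltw : (encVec (List.replicate B (2 * m))).length ≤ B * (2 * n) := by
    rw [show encVec (List.replicate B (2 * m)) = encList ((List.replicate B (2 * m)).map encodeNat) from rfl,
      length_encList, List.map_replicate, List.map_replicate, List.sum_replicate, smul_eq_mul]
    exact Nat.mul_le_mul_left _ (by omega)
  -- the records
  let w1 : GSlots := { w with bf := [], fz := ⟨encBlocks Fb, hold, hold2, tmp, [], [], encodeNat t, [], [], [], [], [], e, l1, l2, dst⟩ }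
  let w2 : GSlots := { w with bf := [], out := encBlocks (Fb.flatMap (chunksPad m t)), twout := encVec (List.replicate B (2 * m)), fz := ⟨[], hold, hold2, tmp, [], [], encodeNat t, [], [], [], [], [], e, l1, l2, dst⟩ }
  let w3 : GSlots := { w with bf := encBlocks (Fb.flatMap (chunksPad m t)), out := [], twout := encVec (List.replicate B (2 * m)), fz := ⟨[], hold, hold2, tmp, [], [], encodeNat t, [], [], [], [], [], e, l1, l2, dst⟩ }
  let w4 : GSlots := { w with bf := encBlocks (Fb.flatMap (chunksPad m t)), out := [], twout := [], fz := ⟨[], hold, hold2, tmp, encVec (List.replicate B (2 * m)), [], encodeNat t, [], [], [], [], [], e, l1, l2, dst⟩ }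
  have h1 : Runs (move (Sum.inr (q .BF)) (Sum.inr (rFG q .IN)) (ra .s)) (base (gSt q T w)) (base (gSt q T w1)) (6 * (B * (2 * (m * t * (2 * n)) + 2)) + 2) := by
    refine (runs_omove (a := q .BF) (b := rFG q .IN) (hgq (by decide)) (gSt q T w)).of_eq ?_ ?_
    · simp [w1, hbf, hfz]
    · simp only [gSt_BF, hbf]; omega
  have h2 : Runs (digitizePass (rFG q)) (base (gSt q T w1)) (base (gSt q T w2)) (digitizeCost n m t B) := by
    have h := runs_digitizePass (rFG q) hn hmn hm2n htn (gBase q T w1) (by simp [w1, hhn]) (by simp [w1, hm2])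
      (by rw [rFG_apply, gBase_v q _ _ (by decide) (by decide)]; exact hW) (by rw [rFG_apply, gBase_v q _ _ (by decide) (by decide)]; exact hTT)
      (by rw [rFG_apply, gBase_v q _ _ (by decide) (by decide)]; exact hU) hFb hold hold2 tmp [] e l1 l2 dst
    refine h.of_eq ?_ le_rfl
    simp only [rFG_apply, gBase_OUT, gBase_TWOUT, w1, hout, htwout, List.append_nil, fSt_gBase, update_gSt_fOUT, update_gSt_fTWOUT, w2, hB]
  have h3 : Runs (move (Sum.inr (rFG q .OUT)) (Sum.inr (q .BF)) (ra .s)) (base (gSt q T w2)) (base (gSt q T w3)) (6 * (B * t * (2 * (2 * m * (2 * n)) + 2)) + 2) := by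
    refine (runs_omove (a := rFG q .OUT) (b := q .BF) (hgq (by decide)) (gSt q T w2)).of_eq ?_ ?_
    · simp [w2, w3]
    · simp only [rFG_apply, gSt_fOUT, w2]; omega
  have h4 : Runs (move (Sum.inr (rFG q .TWOUT)) (Sum.inr (rFG q .TW)) (ra .s)) (base (gSt q T w3)) (base (gSt q T w4)) (6 * (B * (2 * n)) + 2) := by
    refine (runs_omove (a := rFG q .TWOUT) (b := rFG q .TW) (hgq (by decide)) (gSt q T w3)).of_eq ?_ ?_
    · simp [w3, w4]
    · simp only [rFG_apply, gSt_fTWOUT, w3]; omega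
  refine (h1.seq (h2.seq (h3.seq h4))).of_eq (by simp only [w4, hout, htwout]) ?_
  unfold digitCost
  have e1 : B * (2 * (m * t * (2 * n)) + 2) = 4 * (B * (m * t) * n) + 2 * B := by ring
  have e2 : B * t * (2 * (2 * m * (2 * n)) + 2) = 8 * (B * (m * t) * n) + 2 * (B * t) := by ring
  rw [e1, e2]
  nlinarith [Nat.zero_le (B * (m * t) * n), Nat.zero_le (B * t), Nat.zero_le (B * n)]

/-- **`digitBG`.** [folklore] -/
theorem runs_digitBG {N n m t : ℕ} (hn : (encodeNat N).length + 1 ≤ n) (hmn : (encodeNat m).length ≤ n)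
    (hm2n : (encodeNat (2 * m)).length + 1 ≤ n) (htn : (encodeNat t).length ≤ n) (T : Regs β) (hI : DrvInv q N T)
    (w : GSlots) {Fb : List (List ℕ)} (hFb : ∀ b ∈ Fb, (∀ a ∈ b, a < N) ∧ b.length = m * t)
    (hbg : w.bg = encBlocks Fb) (hhn : w.hn = encodeNat m) (hm2 : w.m2 = encodeNat (2 * m)) (hout : w.out = []) (htwout : w.twout = [])
    (hold hold2 tmp e l1 l2 dst : List Bool) (hfz : w.fz = ⟨[], hold, hold2, tmp, [], [], encodeNat t, [], [], [], [], [], e, l1, l2, dst⟩) :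
    Runs (digitBG q) (base (gSt q T w))
      (base (gSt q T { w with bg := encBlocks (Fb.flatMap (chunksPad m t)), tw2 := encVec (List.replicate Fb.length (2 * m)) ++ w.tw2, fz := ⟨[], hold, hold2, tmp, [], [], encodeNat t, [], [], [], [], [], e, l1, l2, dst⟩ }))
      (digitCost n m t Fb.length) := by
  obtain ⟨-, -, -, -, -, -, hW, hTT, -, -, hU, -, -, -, -, -, -, -⟩ := hI
  have hgq : ∀ {i j : GReg}, i ≠ j → q i ≠ q j := fun h => gq_ne q h
  set B := Fb.length with hB
  -- lengths
  have hlin : (encBlocks Fb).length ≤ B * (2 * (m * t * (2 * n)) + 2) := by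
    unfold encBlocks; rw [length_encList, List.map_map]
    have : ∀ x ∈ Fb.map ((fun a : List Bool => 2 * a.length + 2) ∘ encVec), x ≤ 2 * (m * t * (2 * n)) + 2 := by
      intro x hx; rw [List.mem_map] at hx; obtain ⟨u, hu, rfl⟩ := hx
      have h1 := length_encVec_le_of_lt (hFb u hu).1 hn; rw [(hFb u hu).2] at h1; simp only [Function.comp_apply]; omega
    have hs := List.sum_le_card_nsmul _ _ this
    rwa [List.length_map, smul_eq_mul] at hs
  have hov : ∀ c ∈ Fb.flatMap (chunksPad m t), c.length = 2 * m ∧ ∀ a ∈ c, a < N := by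
    intro c hc; rw [List.mem_flatMap] at hc; obtain ⟨b, hb, hc⟩ := hc
    exact (chunksPad_valid m t b (hFb b hb).1 (hFb b hb).2).2 c hc
  have hlout' : (Fb.flatMap (chunksPad m t)).length = B * t := by
    rw [List.length_flatMap, List.map_congr_left (fun b hb => (chunksPad_valid m t b (hFb b hb).1 (hFb b hb).2).1), List.map_const',
      List.sum_replicate, smul_eq_mul]
  have hlout : (encBlocks (Fb.flatMap (chunksPad m t))).length ≤ B * t * (2 * (2 * m * (2 * n)) + 2) := by
    have := length_encBlocks_le (m := m) hn hov; rwa [hlout'] at this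
  have hltw : (encVec (List.replicate B (2 * m))).length ≤ B * (2 * n) := by
    rw [show encVec (List.replicate B (2 * m)) = encList ((List.replicate B (2 * m)).map encodeNat) from rfl,
      length_encList, List.map_replicate, List.map_replicate, List.sum_replicate, smul_eq_mul]
    exact Nat.mul_le_mul_left _ (by omega)
  -- the records
  let w1 : GSlots := { w with bg := [], fz := ⟨encBlocks Fb, hold, hold2, tmp, [], [], encodeNat t, [], [], [], [], [], e, l1, l2, dst⟩ }
  let w2 : GSlots := { w with bg := [], out := encBlocks (Fb.flatMap (chunksPad m t)), twout := encVec (List.replicate B (2 * m)), fz := ⟨[], hold, hold2, tmp, [], [], encodeNat t, [], [], [], [], [], e, l1, l2, dst⟩ }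
  let w3 : GSlots := { w with bg := encBlocks (Fb.flatMap (chunksPad m t)), out := [], twout := encVec (List.replicate B (2 * m)), fz := ⟨[], hold, hold2, tmp, [], [], encodeNat t, [], [], [], [], [], e, l1, l2, dst⟩ }
  let w4 : GSlots := { w with bg := encBlocks (Fb.flatMap (chunksPad m t)), out := [], twout := [], tw2 := encVec (List.replicate B (2 * m)) ++ w.tw2, fz := ⟨[], hold, hold2, tmp, [], [], encodeNat t, [], [], [], [], [], e, l1, l2, dst⟩ }
  have h1 : Runs (move (Sum.inr (q .BG)) (Sum.inr (rFG q .IN)) (ra .s)) (base (gSt q T w)) (base (gSt q T w1)) (6 * (B * (2 * (m * t * (2 * n)) + 2)) + 2) := by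
    refine (runs_omove (a := q .BG) (b := rFG q .IN) (hgq (by decide)) (gSt q T w)).of_eq ?_ ?_
    · simp [w1, hbg, hfz]
    · simp only [gSt_BG, hbg]; omega
  have h2 : Runs (digitizePass (rFG q)) (base (gSt q T w1)) (base (gSt q T w2)) (digitizeCost n m t B) := by
    have h := runs_digitizePass (rFG q) hn hmn hm2n htn (gBase q T w1) (by simp [w1, hhn]) (by simp [w1, hm2])
      (by rw [rFG_apply, gBase_v q _ _ (by decide) (by decide)]; exact hW) (by rw [rFG_apply, gBase_v q _ _ (by decide) (by decide)]; exact hTT)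
      (by rw [rFG_apply, gBase_v q _ _ (by decide) (by decide)]; exact hU) hFb hold hold2 tmp [] e l1 l2 dst
    refine h.of_eq ?_ le_rfl
    simp only [rFG_apply, gBase_OUT, gBase_TWOUT, w1, hout, htwout, List.append_nil, fSt_gBase, update_gSt_fOUT, update_gSt_fTWOUT, w2, hB]
  have h3 : Runs (move (Sum.inr (rFG q .OUT)) (Sum.inr (q .BG)) (ra .s)) (base (gSt q T w2)) (base (gSt q T w3)) (6 * (B * t * (2 * (2 * m * (2 * n)) + 2)) + 2) := by
    refine (runs_omove (a := rFG q .OUT) (b := q .BG) (hgq (by decide)) (gSt q T w2)).of_eq ?_ ?_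
    · simp [w2, w3]
    · simp only [rFG_apply, gSt_fOUT, w2]; omega
  have h4 : Runs (move (Sum.inr (rFG q .TWOUT)) (Sum.inr (q .TW2)) (ra .s)) (base (gSt q T w3)) (base (gSt q T w4)) (6 * (B * (2 * n)) + 2) := by
    refine (runs_omove (a := rFG q .TWOUT) (b := q .TW2) (hgq (by decide)) (gSt q T w3)).of_eq ?_ ?_
    · simp [w3, w4]
    · simp only [rFG_apply, gSt_fTWOUT, w3]; omega
  refine (h1.seq (h2.seq (h3.seq h4))).of_eq (by simp only [w4, hout, htwout]) ?_
  unfold digitCost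
  have e1 : B * (2 * (m * t * (2 * n)) + 2) = 4 * (B * (m * t) * n) + 2 * B := by ring
  have e2 : B * t * (2 * (2 * m * (2 * n)) + 2) = 8 * (B * (m * t) * n) + 2 * (B * t) := by ring
  rw [e1, e2]
  nlinarith [Nat.zero_le (B * (m * t) * n), Nat.zero_le (B * t), Nat.zero_le (B * n)]

/-- The level-pass invariant over the driver's base file. [folklore] -/
theorem lvlInv_gBase {N m : ℕ} {T : Regs β} (hI : DrvInv q N T) (w : GSlots) (hlen : w.len = encodeNat (2 * m))
    (hm2 : w.m2 = encodeNat (2 * m)) (hm4 : w.m4 = encodeNat (4 * m)) : LvlInv (rFG q) N m w.cc (gBase q T w) := by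
  obtain ⟨hMD, hA, hB, hD, hF, hG, hW, hTT, hO, hS, hU, -, -, -, -, -, -, -⟩ := hI
  refine ⟨?_, ?_, ?_, ?_, ?_, ?_, ?_, ?_, ?_, ?_, ?_, ?_, ?_, ?_, ?_⟩ <;> simp only [rFG_apply, gBase_LEN, gBase_C, gBase_M2, gBase_M4, hlen, hm2, hm4]
  all_goals rw [gBase_v q _ _ (by decide) (by decide)]; assumption

/-- Run a forward level pass on the batch `BF` (twiddles in `TW`), children back into `TW`. [folklore] -/
def lvlBF : Com (EReg ⊕ β) :=
  move (Sum.inr (q .BF)) (Sum.inr (rFG q .IN)) (ra .s) ;; (levelPass (rFG q) (pairFwd (rFG q)) ;;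
  (move (Sum.inr (rFG q .OUT)) (Sum.inr (q .BF)) (ra .s) ;; move (Sum.inr (rFG q .TWOUT)) (Sum.inr (rFG q .TW)) (ra .s)))

/-- Cost of a wrapped level pass on `B = 2h|Fs|` blocks of length `2m`. [folklore] -/
def lvlCost (cP n m h nF : ℕ) : ℕ := levelCost cP n m h nF + 192 * (h * nF * (m * n)) + 48 * (h * nF) + 24 * (nF * n) + 24 * nF + 6

/-- **`lvlBF`.** [folklore] -/
theorem runs_lvlBF {N n m h : ℕ} (hn : (encodeNat N).length + 1 ≤ n) (hm4n : (encodeNat (4 * m)).length + 1 ≤ n)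
    (hhn : (encodeNat h).length ≤ n) (T : Regs β) (hI : DrvInv q N T) (w : GSlots) {Fs : List ℕ} {Bs : List (List ℕ)}
    (hFs : ∀ F ∈ Fs, F = 2 * (F / 2) ∧ 1 ≤ F / 2 ∧ F / 2 < 4 * m) (hBs : ∀ b ∈ Bs, b.length = 2 * m ∧ ∀ a ∈ b, a < N)
    (hlenB : Bs.length = 2 * h * Fs.length)
    (hbf : w.bf = encBlocks Bs) (hhnr : w.hn = encodeNat h) (hlen : w.len = encodeNat (2 * m)) (hm2 : w.m2 = encodeNat (2 * m))
    (hm4 : w.m4 = encodeNat (4 * m)) (hout : w.out = []) (htwout : w.twout = [])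
    (hfz : w.fz = ⟨[], [], [], [], encVec Fs, [], [], [], [], [], [], [], [], [], [], []⟩) :
    Runs (lvlBF q) (base (gSt q T w))
      (base (gSt q T { w with bf := encBlocks (levelOut (NegFFT.gF₁ N m) (NegFFT.gF₂ N m) h Fs Bs), fz := ⟨[], [], [], [], encVec (childTw m Fs), [], [], [], [], [], [], [], [], [], [], []⟩ }))
      (lvlCost (pairCost n m) n m h Fs.length) := by
  have hgq : ∀ {i j : GReg}, i ≠ j → q i ≠ q j := fun h => gq_ne q h
  have hmn : (encodeNat (2 * m)).length + 1 ≤ n := (Nat.add_le_add_right (Brick.length_encodeNat_mono (by omega)) 1).trans hm4n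
  set out := levelOut (NegFFT.gF₁ N m) (NegFFT.gF₂ N m) h Fs Bs with hod
  set nF := Fs.length with hnF
  -- lengths
  have hlin : (encBlocks Bs).length ≤ 2 * h * nF * (2 * (2 * m * (2 * n)) + 2) := by
    have := length_encBlocks_le (m := m) hn hBs; rwa [hlenB] at this
  have hov : ∀ b ∈ out, b.length = 2 * m ∧ ∀ a ∈ b, a < N := levelOut_valid (NegFFT.gF₁_valid N m) (NegFFT.gF₂_valid N m) h Fs Bs hBs
  have hlout : (encBlocks out).length ≤ 2 * h * nF * (2 * (2 * m * (2 * n)) + 2) := by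
    have := length_encBlocks_le (m := m) hn hov; rwa [hod, length_levelOut _ _ h Fs Bs hlenB, ← hod] at this
  have hltw : (encVec (childTw m Fs)).length ≤ 2 * nF * (2 * (n + 1)) := by
    rcases Nat.eq_zero_or_pos m with hm | hm
    · have : Fs = [] := by
        rcases Fs with _ | ⟨F, l⟩
        · rfl
        · have := (hFs F (by simp)).2.2; omega
      subst this; simp [childTw]
    · have hct : ∀ x ∈ childTw m Fs, x < 4 * m + 4 * m := by
        intro x hx
        simp only [childTw, List.mem_flatMap, List.mem_cons, List.not_mem_nil, or_false] at hx
        obtain ⟨F, hF, hx⟩ := hx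
        have := (hFs F hF).2.2
        rcases hx with rfl | rfl <;> omega
      have h8 : (encodeNat (4 * m + 4 * m)).length + 1 ≤ n + 1 := by
        rw [show 4 * m + 4 * m = 2 * (4 * m) by ring, encodeNat_two_mul _ (by omega), List.length_cons]; omega
      have := length_encVec_le_of_lt hct h8
      rwa [length_childTw, ← hnF] at this
  -- records
  let w1 : GSlots := { w with bf := [], fz := ⟨encBlocks Bs, [], [], [], encVec Fs, [], [], [], [], [], [], [], [], [], [], []⟩ }
  let w2 : GSlots := { w with bf := [], out := encBlocks out, twout := encVec (childTw m Fs), fz := ⟨[], [], [], [], [], [], [], [], [], [], [], [], [], [], [], []⟩ }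
  let w3 : GSlots := { w with bf := encBlocks out, out := [], twout := encVec (childTw m Fs), fz := ⟨[], [], [], [], [], [], [], [], [], [], [], [], [], [], [], []⟩ }
  let w4 : GSlots := { w with bf := encBlocks out, out := [], twout := [], fz := ⟨[], [], [], [], encVec (childTw m Fs), [], [], [], [], [], [], [], [], [], [], []⟩ }
  have h1 : Runs (move (Sum.inr (q .BF)) (Sum.inr (rFG q .IN)) (ra .s)) (base (gSt q T w)) (base (gSt q T w1)) (6 * (2 * h * nF * (2 * (2 * m * (2 * n)) + 2)) + 2) := by
    refine (runs_omove (a := q .BF) (b := rFG q .IN) (hgq (by decide)) (gSt q T w)).of_eq ?_ ?_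
    · simp [w1, hbf, hfz]
    · simp only [gSt_BF, hbf]; omega
  have h2 : Runs (levelPass (rFG q) (pairFwd (rFG q))) (base (gSt q T w1)) (base (gSt q T w2)) (levelCost (pairCost n m) n m h nF) := by
    have hIl : LvlInv (rFG q) N m w1.cc (gBase q T w1) := lvlInv_gBase q hI w1 (by simp [w1, hlen]) (by simp [w1, hm2]) (by simp [w1, hm4])
    have h := runs_levelPass (rFG q) hIl (pairOp_pairFwd (rFG q) hn hmn (gBase q T w1) hIl) (NegFFT.gF₁_valid N m) (NegFFT.gF₂_valid N m) hn hm4n hhn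
      (by simp [w1, hhnr]) hFs hBs hlenB [] [] [] [] [] [] [] [] [] [] [] rfl rfl rfl rfl rfl rfl rfl rfl rfl rfl rfl
    refine h.of_eq ?_ (by rw [hnF])
    simp only [rFG_apply, gBase_OUT, gBase_TWOUT, w1, hout, htwout, List.append_nil, fSt_gBase, update_gSt_fOUT, update_gSt_fTWOUT, w2, hod]
    rfl
  have h3 : Runs (move (Sum.inr (rFG q .OUT)) (Sum.inr (q .BF)) (ra .s)) (base (gSt q T w2)) (base (gSt q T w3)) (6 * (2 * h * nF * (2 * (2 * m * (2 * n)) + 2)) + 2) := by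
    refine (runs_omove (a := rFG q .OUT) (b := q .BF) (hgq (by decide)) (gSt q T w2)).of_eq ?_ ?_
    · simp [w2, w3]
    · simp only [rFG_apply, gSt_fOUT, w2]; omega
  have h4 : Runs (move (Sum.inr (rFG q .TWOUT)) (Sum.inr (rFG q .TW)) (ra .s)) (base (gSt q T w3)) (base (gSt q T w4)) (6 * (2 * nF * (2 * (n + 1))) + 2) := by
    refine (runs_omove (a := rFG q .TWOUT) (b := rFG q .TW) (hgq (by decide)) (gSt q T w3)).of_eq ?_ ?_
    · simp [w3, w4]
    · simp only [rFG_apply, gSt_fTWOUT, w3]; omega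
  refine (h1.seq (h2.seq (h3.seq h4))).of_eq (by simp only [w4, hout, htwout, hod]) ?_
  unfold lvlCost
  have e1 : 2 * h * nF * (2 * (2 * m * (2 * n)) + 2) = 16 * (h * nF * (m * n)) + 4 * (h * nF) := by ring
  rw [e1]
  nlinarith [Nat.zero_le (h * nF * (m * n)), Nat.zero_le (h * nF), Nat.zero_le (nF * n)]


/-- Run a forward level pass on the batch `BG` with the twiddle copy `TW2` (the live `TW` is saved
in `TWS` meanwhile); the children go back into `TW2`. [folklore] -/
def lvlBG : Com (EReg ⊕ β) :=
  move (Sum.inr (rFG q .TW)) (Sum.inr (q .TWS)) (ra .s) ;; (move (Sum.inr (q .TW2)) (Sum.inr (rFG q .TW)) (ra .s) ;;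
  (move (Sum.inr (q .BG)) (Sum.inr (rFG q .IN)) (ra .s) ;; (levelPass (rFG q) (pairFwd (rFG q)) ;;
  (move (Sum.inr (rFG q .OUT)) (Sum.inr (q .BG)) (ra .s) ;; (move (Sum.inr (rFG q .TWOUT)) (Sum.inr (q .TW2)) (ra .s) ;;
  move (Sum.inr (q .TWS)) (Sum.inr (rFG q .TW)) (ra .s))))))

/-- **`lvlBG`.** [folklore] -/
theorem runs_lvlBG {N n m h : ℕ} (hn : (encodeNat N).length + 1 ≤ n) (hm4n : (encodeNat (4 * m)).length + 1 ≤ n)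
    (hhn : (encodeNat h).length ≤ n) (T : Regs β) (hI : DrvInv q N T) (w : GSlots) {Fs : List ℕ} {Bs : List (List ℕ)}
    (hFs : ∀ F ∈ Fs, F = 2 * (F / 2) ∧ 1 ≤ F / 2 ∧ F / 2 < 4 * m) (hBs : ∀ b ∈ Bs, b.length = 2 * m ∧ ∀ a ∈ b, a < N)
    (hlenB : Bs.length = 2 * h * Fs.length) (tw : List ℕ) (hltw0 : (encVec tw).length ≤ 2 * Fs.length * (2 * (n + 1)))
    (hbg : w.bg = encBlocks Bs) (htw2 : w.tw2 = encVec Fs) (htws : w.tws = []) (hhnr : w.hn = encodeNat h) (hlen : w.len = encodeNat (2 * m))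
    (hm2 : w.m2 = encodeNat (2 * m)) (hm4 : w.m4 = encodeNat (4 * m)) (hout : w.out = []) (htwout : w.twout = [])
    (hfz : w.fz = ⟨[], [], [], [], encVec tw, [], [], [], [], [], [], [], [], [], [], []⟩) :
    Runs (lvlBG q) (base (gSt q T w))
      (base (gSt q T { w with bg := encBlocks (levelOut (NegFFT.gF₁ N m) (NegFFT.gF₂ N m) h Fs Bs), tw2 := encVec (childTw m Fs), fz := ⟨[], [], [], [], encVec tw, [], [], [], [], [], [], [], [], [], [], []⟩ }))
      (lvlCost (pairCost n m) n m h Fs.length + 48 * (Fs.length * (n + 1)) + 30 * (Fs.length * (n + 1)) + 6) := by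
  have hgq : ∀ {i j : GReg}, i ≠ j → q i ≠ q j := fun h => gq_ne q h
  have hmn : (encodeNat (2 * m)).length + 1 ≤ n := (Nat.add_le_add_right (Brick.length_encodeNat_mono (by omega)) 1).trans hm4n
  set out := levelOut (NegFFT.gF₁ N m) (NegFFT.gF₂ N m) h Fs Bs with hod
  set nF := Fs.length with hnF
  have hlin : (encBlocks Bs).length ≤ 2 * h * nF * (2 * (2 * m * (2 * n)) + 2) := by
    have := length_encBlocks_le (m := m) hn hBs; rwa [hlenB] at this
  have hov : ∀ b ∈ out, b.length = 2 * m ∧ ∀ a ∈ b, a < N := levelOut_valid (NegFFT.gF₁_valid N m) (NegFFT.gF₂_valid N m) h Fs Bs hBs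
  have hlout : (encBlocks out).length ≤ 2 * h * nF * (2 * (2 * m * (2 * n)) + 2) := by
    have := length_encBlocks_le (m := m) hn hov; rwa [hod, length_levelOut _ _ h Fs Bs hlenB, ← hod] at this
  have hlF : (encVec Fs).length ≤ nF * (2 * (n + 1)) := by
    rcases Nat.eq_zero_or_pos m with hm | hm
    · have : Fs = [] := by
        rcases Fs with _ | ⟨F, l⟩
        · rfl
        · have := (hFs F (by simp)).2.2; omega
      subst this; simp
    · have hct : ∀ x ∈ Fs, x < 4 * m + 4 * m := fun F hF => by have := hFs F hF; omega
      have h8 : (encodeNat (4 * m + 4 * m)).length + 1 ≤ n + 1 := by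
        rw [show 4 * m + 4 * m = 2 * (4 * m) by ring, encodeNat_two_mul _ (by omega), List.length_cons]; omega
      exact length_encVec_le_of_lt hct h8
  have hltw : (encVec (childTw m Fs)).length ≤ 2 * nF * (2 * (n + 1)) := by
    rcases Nat.eq_zero_or_pos m with hm | hm
    · have : Fs = [] := by
        rcases Fs with _ | ⟨F, l⟩
        · rfl
        · have := (hFs F (by simp)).2.2; omega
      subst this; simp [childTw]
    · have hct : ∀ x ∈ childTw m Fs, x < 4 * m + 4 * m := by
        intro x hx
        simp only [childTw, List.mem_flatMap, List.mem_cons, List.not_mem_nil, or_false] at hx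
        obtain ⟨F, hF, hx⟩ := hx
        have := (hFs F hF).2.2
        rcases hx with rfl | rfl <;> omega
      have h8 : (encodeNat (4 * m + 4 * m)).length + 1 ≤ n + 1 := by
        rw [show 4 * m + 4 * m = 2 * (4 * m) by ring, encodeNat_two_mul _ (by omega), List.length_cons]; omega
      have := length_encVec_le_of_lt hct h8
      rwa [length_childTw, ← hnF] at this
  let e16 : FSlots := ⟨[], [], [], [], [], [], [], [], [], [], [], [], [], [], [], []⟩
  let w1 : GSlots := { w with tws := encVec tw, fz := e16 }
  let w2 : GSlots := { w with tws := encVec tw, tw2 := [], fz := ⟨[], [], [], [], encVec Fs, [], [], [], [], [], [], [], [], [], [], []⟩ }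
  let w3 : GSlots := { w with tws := encVec tw, tw2 := [], bg := [], fz := ⟨encBlocks Bs, [], [], [], encVec Fs, [], [], [], [], [], [], [], [], [], [], []⟩ }
  let w4 : GSlots := { w with tws := encVec tw, tw2 := [], bg := [], out := encBlocks out, twout := encVec (childTw m Fs), fz := e16 }
  let w5 : GSlots := { w with tws := encVec tw, tw2 := [], bg := encBlocks out, out := [], twout := encVec (childTw m Fs), fz := e16 }
  let w6 : GSlots := { w with tws := encVec tw, tw2 := encVec (childTw m Fs), bg := encBlocks out, out := [], twout := [], fz := e16 }
  let w7 : GSlots := { w with tws := [], tw2 := encVec (childTw m Fs), bg := encBlocks out, out := [], twout := [], fz := ⟨[], [], [], [], encVec tw, [], [], [], [], [], [], [], [], [], [], []⟩ }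
  have h1 : Runs (move (Sum.inr (rFG q .TW)) (Sum.inr (q .TWS)) (ra .s)) (base (gSt q T w)) (base (gSt q T w1)) (6 * (2 * nF * (2 * (n + 1))) + 2) := by
    refine (runs_omove (a := rFG q .TW) (b := q .TWS) (hgq (by decide)) (gSt q T w)).of_eq ?_ ?_
    · simp [w1, e16, hfz, htws]
    · simp only [rFG_apply, gSt_sTW, hfz]; omega
  have h2 : Runs (move (Sum.inr (q .TW2)) (Sum.inr (rFG q .TW)) (ra .s)) (base (gSt q T w1)) (base (gSt q T w2)) (6 * (nF * (2 * (n + 1))) + 2) := by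
    refine (runs_omove (a := q .TW2) (b := rFG q .TW) (hgq (by decide)) (gSt q T w1)).of_eq ?_ ?_
    · simp [w1, w2, e16, htw2]
    · simp only [gSt_TW2, w1, htw2]; omega
  have h3 : Runs (move (Sum.inr (q .BG)) (Sum.inr (rFG q .IN)) (ra .s)) (base (gSt q T w2)) (base (gSt q T w3)) (6 * (2 * h * nF * (2 * (2 * m * (2 * n)) + 2)) + 2) := by
    refine (runs_omove (a := q .BG) (b := rFG q .IN) (hgq (by decide)) (gSt q T w2)).of_eq ?_ ?_
    · simp [w2, w3, hbg]
    · simp only [gSt_BG, w2, hbg]; omega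
  have h4 : Runs (levelPass (rFG q) (pairFwd (rFG q))) (base (gSt q T w3)) (base (gSt q T w4)) (levelCost (pairCost n m) n m h nF) := by
    have hIl : LvlInv (rFG q) N m w3.cc (gBase q T w3) := lvlInv_gBase q hI w3 (by simp [w3, hlen]) (by simp [w3, hm2]) (by simp [w3, hm4])
    have h := runs_levelPass (rFG q) hIl (pairOp_pairFwd (rFG q) hn hmn (gBase q T w3) hIl) (NegFFT.gF₁_valid N m) (NegFFT.gF₂_valid N m) hn hm4n hhn
      (by simp [w3, hhnr]) hFs hBs hlenB [] [] [] [] [] [] [] [] [] [] [] rfl rfl rfl rfl rfl rfl rfl rfl rfl rfl rfl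
    refine h.of_eq ?_ (by rw [hnF])
    simp only [rFG_apply, gBase_OUT, gBase_TWOUT, w3, hout, htwout, List.append_nil, fSt_gBase, update_gSt_fOUT, update_gSt_fTWOUT, w4, hod, e16]
    rfl
  have h5 : Runs (move (Sum.inr (rFG q .OUT)) (Sum.inr (q .BG)) (ra .s)) (base (gSt q T w4)) (base (gSt q T w5)) (6 * (2 * h * nF * (2 * (2 * m * (2 * n)) + 2)) + 2) := by
    refine (runs_omove (a := rFG q .OUT) (b := q .BG) (hgq (by decide)) (gSt q T w4)).of_eq ?_ ?_
    · simp [w4, w5]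
    · simp only [rFG_apply, gSt_fOUT, w4]; omega
  have h6 : Runs (move (Sum.inr (rFG q .TWOUT)) (Sum.inr (q .TW2)) (ra .s)) (base (gSt q T w5)) (base (gSt q T w6)) (6 * (2 * nF * (2 * (n + 1))) + 2) := by
    refine (runs_omove (a := rFG q .TWOUT) (b := q .TW2) (hgq (by decide)) (gSt q T w5)).of_eq ?_ ?_
    · simp [w5, w6]
    · simp only [rFG_apply, gSt_fTWOUT, w5]; omega
  have h7 : Runs (move (Sum.inr (q .TWS)) (Sum.inr (rFG q .TW)) (ra .s)) (base (gSt q T w6)) (base (gSt q T w7)) (6 * (2 * nF * (2 * (n + 1))) + 2) := by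
    refine (runs_omove (a := q .TWS) (b := rFG q .TW) (hgq (by decide)) (gSt q T w6)).of_eq ?_ ?_
    · simp [w6, w7, e16]
    · simp only [gSt_TWS, w6]; omega
  refine (h1.seq (h2.seq (h3.seq (h4.seq (h5.seq (h6.seq h7)))))).of_eq (by simp only [w7, hout, htwout, htws, hod]) ?_
  unfold lvlCost
  have e1 : 2 * h * nF * (2 * (2 * m * (2 * n)) + 2) = 16 * (h * nF * (m * n)) + 4 * (h * nF) := by ring
  rw [e1]
  nlinarith [Nat.zero_le (h * nF * (m * n)), Nat.zero_le (h * nF), Nat.zero_le (nF * n)]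


/-- Run an inverse level pass on the results `RR`: pop the level's twiddle list from `HIST` into
`TW`, move `RR` into `IN`, run, move `OUT` back, discard the children. [folklore] -/
def lvlRR : Com (EReg ⊕ β) :=
  readItemTo (Sum.inr (q .HIST)) (Sum.inr (rFG q .TW)) (Sum.inr (rVG q .W)) (Sum.inr (rVG q .TT)) ;;
  (move (Sum.inr (q .RR)) (Sum.inr (rFG q .IN)) (ra .s) ;; (levelPass (rFG q) (pairInv (rFG q)) ;;
  (move (Sum.inr (rFG q .OUT)) (Sum.inr (q .RR)) (ra .s) ;; clear (Sum.inr (rFG q .TWOUT)))))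

/-- **`lvlRR`.** [folklore] -/
theorem runs_lvlRR {N n m h : ℕ} (hN1 : 1 < N) (hn : (encodeNat N).length + 1 ≤ n) (hm4n : (encodeNat (4 * m)).length + 1 ≤ n)
    (hhn : (encodeNat h).length ≤ n) (T : Regs β) (hI : DrvInv q N T) (w : GSlots) {Fs : List ℕ} {Bs : List (List ℕ)} {rest : List (List Bool)}
    (hFs : ∀ F ∈ Fs, F = 2 * (F / 2) ∧ 1 ≤ F / 2 ∧ F / 2 < 4 * m) (hBs : ∀ b ∈ Bs, b.length = 2 * m ∧ ∀ a ∈ b, a < N)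
    (hlenB : Bs.length = 2 * h * Fs.length)
    (hrr : w.rr = encBlocks Bs) (hhist : w.hist = encList (encVec Fs :: rest)) (hhnr : w.hn = encodeNat h) (hlen : w.len = encodeNat (2 * m))
    (hm2 : w.m2 = encodeNat (2 * m)) (hm4 : w.m4 = encodeNat (4 * m)) (hcc : w.cc = encodeNat (NegFFT.inv2N N)) (hout : w.out = []) (htwout : w.twout = [])
    (hfz : w.fz = ⟨[], [], [], [], [], [], [], [], [], [], [], [], [], [], [], []⟩) :
    Runs (lvlRR q) (base (gSt q T w))
      (base (gSt q T { w with rr := encBlocks (levelOut (NegFFT.gI₁ N) (NegFFT.gI₂ N m) h Fs Bs), hist := encList rest }))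
      (lvlCost (pairInvCost n m) n m h Fs.length + 20 * (Fs.length * (n + 1)) + 12) := by
  have hgq : ∀ {i j : GReg}, i ≠ j → q i ≠ q j := fun h => gq_ne q h
  have hW : T (q (.f (.n (.v .W)))) = [] := hI.2.2.2.2.2.2.1
  have hTT : T (q (.f (.n (.v .TT)))) = [] := hI.2.2.2.2.2.2.2.1
  set out := levelOut (NegFFT.gI₁ N) (NegFFT.gI₂ N m) h Fs Bs with hod
  set nF := Fs.length with hnF
  have hlin : (encBlocks Bs).length ≤ 2 * h * nF * (2 * (2 * m * (2 * n)) + 2) := by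
    have := length_encBlocks_le (m := m) hn hBs; rwa [hlenB] at this
  have hov : ∀ b ∈ out, b.length = 2 * m ∧ ∀ a ∈ b, a < N := levelOut_valid (NegFFT.gI₁_valid N m) (NegFFT.gI₂_valid N m) h Fs Bs hBs
  have hlout : (encBlocks out).length ≤ 2 * h * nF * (2 * (2 * m * (2 * n)) + 2) := by
    have := length_encBlocks_le (m := m) hn hov; rwa [hod, length_levelOut _ _ h Fs Bs hlenB, ← hod] at this
  have hlF : (encVec Fs).length ≤ nF * (2 * (n + 1)) := by
    rcases Nat.eq_zero_or_pos m with hm | hm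
    · have : Fs = [] := by
        rcases Fs with _ | ⟨F, l⟩
        · rfl
        · have := (hFs F (by simp)).2.2; omega
      subst this; simp
    · have hct : ∀ x ∈ Fs, x < 4 * m + 4 * m := fun F hF => by have := hFs F hF; omega
      have h8 : (encodeNat (4 * m + 4 * m)).length + 1 ≤ n + 1 := by
        rw [show 4 * m + 4 * m = 2 * (4 * m) by ring, encodeNat_two_mul _ (by omega), List.length_cons]; omega
      exact length_encVec_le_of_lt hct h8
  have hltw : (encVec (childTw m Fs)).length ≤ 2 * nF * (2 * (n + 1)) := by
    rcases Nat.eq_zero_or_pos m with hm | hm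
    · have : Fs = [] := by
        rcases Fs with _ | ⟨F, l⟩
        · rfl
        · have := (hFs F (by simp)).2.2; omega
      subst this; simp [childTw]
    · have hct : ∀ x ∈ childTw m Fs, x < 4 * m + 4 * m := by
        intro x hx
        simp only [childTw, List.mem_flatMap, List.mem_cons, List.not_mem_nil, or_false] at hx
        obtain ⟨F, hF, hx⟩ := hx
        have := (hFs F hF).2.2
        rcases hx with rfl | rfl <;> omega
      have h8 : (encodeNat (4 * m + 4 * m)).length + 1 ≤ n + 1 := by
        rw [show 4 * m + 4 * m = 2 * (4 * m) by ring, encodeNat_two_mul _ (by omega), List.length_cons]; omega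
      have := length_encVec_le_of_lt hct h8
      rwa [length_childTw, ← hnF] at this
  let e16 : FSlots := ⟨[], [], [], [], [], [], [], [], [], [], [], [], [], [], [], []⟩
  let w1 : GSlots := { w with hist := encList rest, fz := ⟨[], [], [], [], encVec Fs, [], [], [], [], [], [], [], [], [], [], []⟩ }
  let w2 : GSlots := { w with hist := encList rest, rr := [], fz := ⟨encBlocks Bs, [], [], [], encVec Fs, [], [], [], [], [], [], [], [], [], [], []⟩ }
  let w3 : GSlots := { w with hist := encList rest, rr := [], out := encBlocks out, twout := encVec (childTw m Fs), fz := e16 }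
  let w4 : GSlots := { w with hist := encList rest, rr := encBlocks out, out := [], twout := encVec (childTw m Fs), fz := e16 }
  let w5 : GSlots := { w with hist := encList rest, rr := encBlocks out, out := [], twout := [], fz := e16 }
  have h1 : Runs (readItemTo (Sum.inr (q .HIST)) (Sum.inr (rFG q .TW)) (Sum.inr (rVG q .W)) (Sum.inr (rVG q .TT))) (base (gSt q T w))
      (base (gSt q T w1)) (11 * (nF * (2 * (n + 1))) + 9) := by
    refine (runs_readItemTo (by simp [hgq]) (by simp [hgq]) (by simp [hgq]) (by simp [hgq]) (by simp [hgq]) (encVec Fs) (encList rest)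
      (base (gSt q T w)) (by simp [hhist, encList, boolPair, dbl]) (by simp [gSt_v q T w, hW]) (by simp [gSt_v q T w, hTT])).of_eq ?_ (by omega)
    simp [w1, hfz]
  have h2 : Runs (move (Sum.inr (q .RR)) (Sum.inr (rFG q .IN)) (ra .s)) (base (gSt q T w1)) (base (gSt q T w2)) (6 * (2 * h * nF * (2 * (2 * m * (2 * n)) + 2)) + 2) := by
    refine (runs_omove (a := q .RR) (b := rFG q .IN) (hgq (by decide)) (gSt q T w1)).of_eq ?_ ?_
    · simp [w1, w2, hrr]
    · simp only [gSt_RR, w1, hrr]; omega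
  have h3 : Runs (levelPass (rFG q) (pairInv (rFG q))) (base (gSt q T w2)) (base (gSt q T w3)) (levelCost (pairInvCost n m) n m h nF) := by
    have hIl : LvlInv (rFG q) N m w2.cc (gBase q T w2) := lvlInv_gBase q hI w2 (by simp [w2, hlen]) (by simp [w2, hm2]) (by simp [w2, hm4])
    rw [show w2.cc = encodeNat (NegFFT.inv2N N) by simp [w2, hcc]] at hIl
    have h := runs_levelPass (rFG q) hIl (pairOp_pairInv (rFG q) hn hm4n (NegFFT.inv2N_lt hN1) (gBase q T w2) hIl) (NegFFT.gI₁_valid N m) (NegFFT.gI₂_valid N m)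
      hn hm4n hhn (by simp [w2, hhnr]) hFs hBs hlenB [] [] [] [] [] [] [] [] [] [] [] rfl rfl rfl rfl rfl rfl rfl rfl rfl rfl rfl
    refine h.of_eq ?_ (by rw [hnF])
    simp only [rFG_apply, gBase_OUT, gBase_TWOUT, w2, hout, htwout, List.append_nil, fSt_gBase, update_gSt_fOUT, update_gSt_fTWOUT, w3, hod, e16]
    rfl
  have h4 : Runs (move (Sum.inr (rFG q .OUT)) (Sum.inr (q .RR)) (ra .s)) (base (gSt q T w3)) (base (gSt q T w4)) (6 * (2 * h * nF * (2 * (2 * m * (2 * n)) + 2)) + 2) := by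
    refine (runs_omove (a := rFG q .OUT) (b := q .RR) (hgq (by decide)) (gSt q T w3)).of_eq ?_ ?_
    · simp [w3, w4]
    · simp only [rFG_apply, gSt_fOUT, w3]; omega
  have h5 : Runs (clear (Sum.inr (rFG q .TWOUT))) (base (gSt q T w4)) (base (gSt q T w5)) (2 * (2 * nF * (2 * (n + 1))) + 1) := by
    refine (runs_clear (Sum.inr (rFG q .TWOUT)) (base (gSt q T w4))).of_eq (by simp [w4, w5]) ?_
    change 2 * (gSt q T w4 (rFG q .TWOUT)).length + 1 ≤ _
    simp only [rFG_apply, gSt_fTWOUT, w4]; omega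
  refine (h1.seq (h2.seq (h3.seq (h4.seq h5)))).of_eq (by simp only [w5, hout, htwout, hfz, hod, e16]) ?_
  unfold lvlCost
  have e1 : 2 * h * nF * (2 * (2 * m * (2 * n)) + 2) = 16 * (h * nF * (m * n)) + 4 * (h * nF) := by ring
  rw [e1]
  nlinarith [Nat.zero_le (h * nF * (m * n)), Nat.zero_le (h * nF), Nat.zero_le (nF * n)]


/-- The base step: the leaf batches are multiplied pairwise by the schoolbook multiplier; the
products go to `RR`. [folklore] -/
def baseStep : Com (EReg ⊕ β) :=
  move (Sum.inr (q .BF)) (Sum.inr (rFG q .IN)) (ra .s) ;; (move (Sum.inr (q .BG)) (Sum.inr (rFG q .HOLD2)) (ra .s) ;;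
  (basePass (rFG q) ;; move (Sum.inr (rFG q .OUT)) (Sum.inr (q .RR)) (ra .s)))

/-- Cost of the base step on `B` pairs of blocks of length `L`. [folklore] -/
def baseStepCost (n L B : ℕ) : ℕ := basePassCost n L B + 36 * (B * (L * (2 * n))) + 36 * B + 6

/-- **The base step.** [folklore] -/
theorem runs_baseStep {N n L : ℕ} (hn : (encodeNat N).length + 1 ≤ n) (hLn : (encodeNat L).length + 1 ≤ n) (T : Regs β)
    (hI : DrvInv q N T) (w : GSlots) {Fb Gb : List (List ℕ)} (hF : ∀ f ∈ Fb, f.length = L ∧ ∀ a ∈ f, a < N)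
    (hG : ∀ g ∈ Gb, g.length = L ∧ ∀ a ∈ g, a < N) (hlenFG : Fb.length = Gb.length)
    (hbf : w.bf = encBlocks Fb) (hbg : w.bg = encBlocks Gb) (hrr : w.rr = []) (hlen : w.len = encodeNat L) (hcc : w.cc = []) (hout : w.out = [])
    (hfz : w.fz = ⟨[], [], [], [], [], [], [], [], [], [], [], [], [], [], [], []⟩) :
    Runs (baseStep q) (base (gSt q T w))
      (base (gSt q T { w with bf := [], bg := [], rr := encBlocks (List.zipWith (negMul N L) Fb Gb) }))
      (baseStepCost n L Fb.length) := by
  have hgq : ∀ {i j : GReg}, i ≠ j → q i ≠ q j := fun h => gq_ne q h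
  obtain ⟨hMD, hA, hB, hD, hF', hG', hW, hTT, hO, hS, hU, hFP, hGP, hACC, -, hL1, hL2, hDST⟩ := hI
  set B := Fb.length with hB0
  have hlf : (encBlocks Fb).length ≤ B * (2 * (L * (2 * n)) + 2) := by
    unfold encBlocks; rw [length_encList, List.map_map]
    have : ∀ x ∈ Fb.map ((fun a : List Bool => 2 * a.length + 2) ∘ encVec), x ≤ 2 * (L * (2 * n)) + 2 := by
      intro x hx; rw [List.mem_map] at hx; obtain ⟨u, hu, rfl⟩ := hx
      have h1 := length_encVec_le_of_lt (hF u hu).2 hn; rw [(hF u hu).1] at h1; simp only [Function.comp_apply]; omega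
    have hs := List.sum_le_card_nsmul _ _ this
    rwa [List.length_map, smul_eq_mul] at hs
  have hlg : (encBlocks Gb).length ≤ B * (2 * (L * (2 * n)) + 2) := by
    unfold encBlocks; rw [length_encList, List.map_map]
    have : ∀ x ∈ Gb.map ((fun a : List Bool => 2 * a.length + 2) ∘ encVec), x ≤ 2 * (L * (2 * n)) + 2 := by
      intro x hx; rw [List.mem_map] at hx; obtain ⟨u, hu, rfl⟩ := hx
      have h1 := length_encVec_le_of_lt (hG u hu).2 hn; rw [(hG u hu).1] at h1; simp only [Function.comp_apply]; omega
    have hs := List.sum_le_card_nsmul _ _ this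
    rwa [List.length_map, ← hlenFG, smul_eq_mul] at hs
  set out := List.zipWith (negMul N L) Fb Gb with hod
  have hov : ∀ c ∈ out, c.length = L ∧ ∀ a ∈ c, a < N := by
    intro c hc
    obtain ⟨f, hf, g, hg, rfl⟩ := exists_mem_of_mem_zipWith hc
    refine ⟨length_negMul f (hG g hg).1, fun a ha => ?_⟩
    rcases Nat.eq_zero_or_pos N with hN | hN
    · exfalso
      rcases f with _ | ⟨b, _⟩
      · have hL : L = 0 := by simpa using (hF _ hf).1.symm
        subst hL; have := length_negMul (N := N) [] (hG g hg).1; rw [List.length_eq_zero_iff] at this; rw [this] at ha; simp at ha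
      · have := (hF _ hf).2 b (by simp); omega
    · exact lt_of_mem_negMul hN f g ha
  have hlo : (encBlocks out).length ≤ B * (2 * (L * (2 * n)) + 2) := by
    unfold encBlocks; rw [length_encList, List.map_map]
    have : ∀ x ∈ out.map ((fun a : List Bool => 2 * a.length + 2) ∘ encVec), x ≤ 2 * (L * (2 * n)) + 2 := by
      intro x hx; rw [List.mem_map] at hx; obtain ⟨u, hu, rfl⟩ := hx
      have h1 := length_encVec_le_of_lt (hov u hu).2 hn; rw [(hov u hu).1] at h1; simp only [Function.comp_apply]; omega
    have hs := List.sum_le_card_nsmul _ _ this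
    rwa [List.length_map, show out.length = B by rw [hod, List.length_zipWith, ← hlenFG, min_self], smul_eq_mul] at hs
  let e16 : FSlots := ⟨[], [], [], [], [], [], [], [], [], [], [], [], [], [], [], []⟩
  let w1 : GSlots := { w with bf := [], fz := ⟨encBlocks Fb, [], [], [], [], [], [], [], [], [], [], [], [], [], [], []⟩ }
  let w2 : GSlots := { w with bf := [], bg := [], fz := ⟨encBlocks Fb, [], encBlocks Gb, [], [], [], [], [], [], [], [], [], [], [], [], []⟩ }
  let w3 : GSlots := { w with bf := [], bg := [], out := encBlocks out, fz := e16 }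
  let w4 : GSlots := { w with bf := [], bg := [], out := [], rr := encBlocks out, fz := e16 }
  have h1 : Runs (move (Sum.inr (q .BF)) (Sum.inr (rFG q .IN)) (ra .s)) (base (gSt q T w)) (base (gSt q T w1)) (6 * (B * (2 * (L * (2 * n)) + 2)) + 2) := by
    refine (runs_omove (a := q .BF) (b := rFG q .IN) (hgq (by decide)) (gSt q T w)).of_eq ?_ ?_
    · simp [w1, hbf, hfz]
    · simp only [gSt_BF, hbf]; omega
  have h2 : Runs (move (Sum.inr (q .BG)) (Sum.inr (rFG q .HOLD2)) (ra .s)) (base (gSt q T w1)) (base (gSt q T w2)) (6 * (B * (2 * (L * (2 * n)) + 2)) + 2) := by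
    refine (runs_omove (a := q .BG) (b := rFG q .HOLD2) (hgq (by decide)) (gSt q T w1)).of_eq ?_ ?_
    · simp [w1, w2, hbg]
    · simp only [gSt_BG, w1, hbg]; omega
  have h3 : Runs (basePass (rFG q)) (base (gSt q T w2)) (base (gSt q T w3)) (basePassCost n L B) := by
    have hBI : BaseInv (rFG q) N L (gBase q T w2) := by
      refine ⟨⟨?_, ?_, ?_, ?_, ?_, ?_, ?_, ?_, ?_, ?_, ?_, ?_, ?_, ?_, ?_, ?_⟩, ?_, ?_, ?_⟩ <;>
        simp only [rNF, rFG, Function.Embedding.trans_apply, GReg.ιF_apply, FReg.ιN_apply, gBase_LEN, gBase_C, w2, hlen, hcc]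
      all_goals first
        | (rw [gBase_v q _ _ (by decide) (by decide)]; assumption)
        | (rw [gBase_n q _ _ (by decide) (by decide)]; assumption)
    have h := runs_basePass (rFG q) hn hLn (gBase q T w2) hBI hF hG hlenFG [] [] [] [] [] [] [] [] []
    refine h.of_eq ?_ (by rw [hB0])
    simp only [rFG_apply, gBase_OUT, w2, hout, List.append_nil, fSt_gBase, update_gSt_fOUT, w3, hod, e16]
  have h4 : Runs (move (Sum.inr (rFG q .OUT)) (Sum.inr (q .RR)) (ra .s)) (base (gSt q T w3)) (base (gSt q T w4)) (6 * (B * (2 * (L * (2 * n)) + 2)) + 2) := by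
    refine (runs_omove (a := rFG q .OUT) (b := q .RR) (hgq (by decide)) (gSt q T w3)).of_eq ?_ ?_
    · simp [w3, w4, hrr]
    · simp only [rFG_apply, gSt_fOUT, w3]; omega
  refine (h1.seq (h2.seq (h3.seq h4))).of_eq (by simp only [w4, hout, hfz, hod, e16]) ?_
  unfold baseStepCost
  have e1 : B * (2 * (L * (2 * n)) + 2) = 2 * (B * (L * (2 * n))) + 2 * B := by ring
  rw [e1]; omega


/-- Length of a batch of valid blocks of length `L`. [folklore] -/
theorem length_encBlocks_le_of_len {N n L : ℕ} (hn : (encodeNat N).length + 1 ≤ n) {Bs : List (List ℕ)}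
    (hBs : ∀ b ∈ Bs, b.length = L ∧ ∀ a ∈ b, a < N) : (encBlocks Bs).length ≤ Bs.length * (2 * (L * (2 * n)) + 2) := by
  unfold encBlocks; rw [length_encList, List.map_map]
  have : ∀ x ∈ Bs.map ((fun a : List Bool => 2 * a.length + 2) ∘ encVec), x ≤ 2 * (L * (2 * n)) + 2 := by
    intro x hx; rw [List.mem_map] at hx; obtain ⟨u, hu, rfl⟩ := hx
    have h1 := length_encVec_le_of_lt (hBs u hu).2 hn; rw [(hBs u hu).1] at h1; simp only [Function.comp_apply]; omega
  have hs := List.sum_le_card_nsmul _ _ this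
  rwa [List.length_map, smul_eq_mul] at hs

/-- Nonempty chunks as (head, rest) pairs. [folklore] -/
theorem exists_insts (f : List (List ℕ) → List ℕ) : ∀ (Ds : List (List (List ℕ))), (∀ D ∈ Ds, D ≠ []) →
    ∃ insts : List (List ℕ × List (List ℕ)), (insts.flatMap fun p => p.1 :: p.2) = Ds.flatten ∧
      (insts.map fun p => f (p.1 :: p.2)) = Ds.map f ∧ (∀ p ∈ insts, p.1 :: p.2 ∈ Ds) ∧ insts.length = Ds.length
  | [], _ => ⟨[], rfl, rfl, fun _ h => by simp at h, rfl⟩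
  | D :: Ds, hDs => by
    obtain ⟨a, l, rfl⟩ : ∃ a l, D = a :: l := by
      cases D with
      | nil => exact absurd rfl (hDs [] (by simp))
      | cons a l => exact ⟨a, l, rfl⟩
    obtain ⟨insts, h1, h2, h3, h4⟩ := exists_insts f Ds (fun D hD => hDs D (by simp [hD]))
    exact ⟨(a, l) :: insts, by rw [List.flatMap_cons, h1, List.flatten_cons], by rw [List.map_cons, h2, List.map_cons],
      fun p hp => by
        rw [List.mem_cons] at hp
        rcases hp with rfl | hp
        · simp
        · exact List.mem_cons_of_mem _ (h3 p hp), by rw [List.length_cons, h4, List.length_cons]⟩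

/-- The overlap-add stage on the results `RR`: item-reverse, overlap-add every instance, item-reverse
back. [folklore] -/
def oaRR : Com (EReg ⊕ β) :=
  move (Sum.inr (q .RR)) (Sum.inr (rFG q .IN)) (ra .s) ;; (revPass (rFG q) ;; (move (Sum.inr (rFG q .HOLD)) (Sum.inr (rFG q .IN)) (ra .s) ;;
  (oaPass (rFG q) ;; (move (Sum.inr (rFG q .OUT)) (Sum.inr (rFG q .IN)) (ra .s) ;; (revPass (rFG q) ;;
  move (Sum.inr (rFG q .HOLD)) (Sum.inr (q .RR)) (ra .s))))))

/-- Cost of the overlap-add stage on `B` instances of `t` blocks of length `2m`. [folklore] -/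
def oaRRCost (n m t B : ℕ) : ℕ :=
  revPassCost n (2 * m) (B * t) + revPassCost n (m * t) B + oaPassCost n m t B + 144 * (B * t * (m * n)) + 24 * (B * t) + 24 * B + 8

/-- **The overlap-add stage.** With `RR = encBlocks Cs.flatten` (the instances' chunks of `t ≥ 1`
valid blocks of length `2m`), `HN = m`, `T1 = t`: `RR := encBlocks (Cs.map (overlapAdd N m))`.
[folklore] -/
theorem runs_oaRR {N n m t : ℕ} (hn : (encodeNat N).length + 1 ≤ n) (hmn : (encodeNat m).length ≤ n) (htn : (encodeNat t).length ≤ n)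
    (T : Regs β) (hI : DrvInv q N T) (w : GSlots) {Cs : List (List (List ℕ))} (hCs : ∀ C ∈ Cs, C.length = t ∧ ∀ b ∈ C, b.length = 2 * m ∧ ∀ a ∈ b, a < N)
    (ht : 1 ≤ t) (hrr : w.rr = encBlocks Cs.flatten) (hhnr : w.hn = encodeNat m) (hout : w.out = [])
    (hfz : w.fz = ⟨[], [], [], [], [], [], encodeNat t, [], [], [], [], [], [], [], [], []⟩) :
    Runs (oaRR q) (base (gSt q T w)) (base (gSt q T { w with rr := encBlocks (Cs.map (NegFFT.overlapAdd N m)) })) (oaRRCost n m t Cs.length) := by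
  have hgq : ∀ {i j : GReg}, i ≠ j → q i ≠ q j := fun h => gq_ne q h
  obtain ⟨hMD, hA, hB, hD, hF, -, hW, hTT, hO, -, hU, -, -, -, -, -, -, -⟩ := hI
  set B := Cs.length with hB0
  have hne : ∀ C ∈ Cs, C ≠ [] := fun C hC h => by have := (hCs C hC).1; rw [h] at this; simp at this; omega
  -- the reversed instances
  set Ds := (Cs.map List.reverse).reverse with hDs
  have hDne : ∀ D ∈ Ds, D ≠ [] := fun D hD => by
    rw [hDs, List.mem_reverse, List.mem_map] at hD
    obtain ⟨C, hC, rfl⟩ := hD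
    simpa using hne C hC
  obtain ⟨insts, hi1, hi2, hi3, hi4⟩ := exists_insts (oaResult N m) Ds hDne
  have hflat : Cs.flatten.reverse = Ds.flatten := by rw [hDs, List.reverse_flatten]
  have hblk : ∀ b ∈ Cs.flatten, b.length = 2 * m ∧ ∀ a ∈ b, a < N := fun b hb => by
    rw [List.mem_flatten] at hb; obtain ⟨C, hC, hb⟩ := hb; exact (hCs C hC).2 b hb
  have hI1 : ∀ p ∈ insts, ∀ b ∈ p.1 :: p.2, b.length = 2 * m ∧ ∀ a ∈ b, a < N := by
    intro p hp b hb
    have hD := hi3 p hp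
    rw [hDs, List.mem_reverse, List.mem_map] at hD
    obtain ⟨C, hC, hCD⟩ := hD
    exact (hCs C hC).2 b (by rw [← List.mem_reverse, hCD]; exact hb)
  have hI2 : ∀ p ∈ insts, p.2.length + 1 = t := by
    intro p hp
    have hD := hi3 p hp
    rw [hDs, List.mem_reverse, List.mem_map] at hD
    obtain ⟨C, hC, hCD⟩ := hD
    have := congrArg List.length hCD
    rw [List.length_reverse, (hCs C hC).1, List.length_cons] at this; omega
  have hres : insts.map (fun p => oaResult N m (p.1 :: p.2)) = (Cs.map (NegFFT.overlapAdd N m)).reverse := by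
    rw [hi2, hDs, List.map_reverse, List.map_map]
    congr 1
    exact List.map_congr_left fun C hC => oaResult_reverse N m C (hne C hC)
  have hlinst : insts.length = B := by rw [hi4, hDs, List.length_reverse, List.length_map]
  -- validity and lengths of the results
  have hovv : ∀ c ∈ Cs.map (NegFFT.overlapAdd N m), c.length = 2 * (m * t / 2) + (m * t) % 2 ∧ ∀ a ∈ c, a < N := by
    intro c hc
    have hc' : c ∈ insts.map (fun p => oaResult N m (p.1 :: p.2)) := by rw [hres, List.mem_reverse]; exact hc
    rw [List.mem_map] at hc'
    obtain ⟨p, hp, rfl⟩ := hc'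
    -- reuse the bound proved inside `runs_oaPass` via `oaLoop_valid`
    have hC := hI1 p hp p.1 (by simp)
    have hN : 0 < N ∨ m = 0 := by
      rcases h : p.1 with _ | ⟨b, _⟩
      · right; have := hC.1; rw [h] at this; simp at this; omega
      · left; exact (Nat.zero_le b).trans_lt (hC.2 b (by simp [h]))
    rcases hN with hN | hm
    swap
    · subst hm
      have key : ∀ (D₁ : List (List ℕ)) (lp acc : List ℕ), lp = [] → acc = [] → (∀ B' ∈ D₁, B' ∈ p.2) → oaLoop N 0 lp D₁ acc = ([], []) := by
        intro D₁; induction D₁ with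
        | nil => intro lp acc h1 h2 _; simp [oaLoop, h1, h2]
        | cons B' D₁ ih =>
          intro lp acc h1 h2 hs
          rw [oaLoop]
          have hB : B' = [] := List.eq_nil_of_length_eq_zero (by have := (hI1 p hp B' (by simp [hs B' (by simp)])).1; omega)
          exact ih _ _ rfl (by subst h1; subst h2; subst hB; simp [vaddMod]) (fun B'' hB'' => hs B'' (by simp [hB'']))
      have hp1 : p.1 = [] := List.eq_nil_of_length_eq_zero (by have := hC.1; omega)
      rw [oaResult, key p.2 _ _ (by simp [hp1]) rfl (fun _ h => h)]
      simp [hp1, vsubMod]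
    · have hlo : (p.1.take m).length = m ∧ ∀ a ∈ p.1.take m, a < N :=
        ⟨by rw [List.length_take, hC.1]; omega, fun a ha => hC.2 a (List.mem_of_mem_take ha)⟩
      have hv := oaLoop_valid hN (p.1.take m) p.2 [] hlo (fun B' hB' => hI1 p hp B' (by simp [hB'])) (by simp)
      rw [oaResult]
      refine ⟨?_, fun a ha => ?_⟩
      · rw [List.length_append, length_vsubMod, hv.1.1, List.length_drop, hC.1, hv.2.1, List.length_nil, zero_add,
          show 2 * m - m = m by omega, min_self, show m + m * p.2.length = m * t by rw [← hI2 p hp]; ring]; omega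
      · rw [List.mem_append] at ha
        rcases ha with ha | ha
        · exact lt_of_mem_vsubMod hN ha
        · exact hv.2.2 a ha
  set outs := Cs.map (NegFFT.overlapAdd N m) with houts
  have hovv' : ∀ c ∈ outs, c.length = m * t ∧ ∀ a ∈ c, a < N := fun c hc => by
    have h := hovv c hc; exact ⟨by rw [h.1]; omega, h.2⟩
  have hovvR : ∀ c ∈ outs.reverse, c.length = m * t ∧ ∀ a ∈ c, a < N := fun c hc => hovv' c (List.mem_reverse.1 hc)
  have hlouts : outs.length = B := by rw [houts, List.length_map]
  -- lengths
  have hlenCF : Cs.flatten.length = B * t := by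
    rw [List.length_flatten, List.map_congr_left (fun C hC => (hCs C hC).1), List.map_const', List.sum_replicate, smul_eq_mul]
  have hlin : (encBlocks Cs.flatten).length ≤ B * t * (2 * (2 * m * (2 * n)) + 2) := by
    have := length_encBlocks_le (m := m) hn hblk; rwa [hlenCF] at this
  have hblkR : ∀ b ∈ Cs.flatten.reverse, b.length = 2 * m ∧ ∀ a ∈ b, a < N := fun b hb => hblk b (List.mem_reverse.1 hb)
  have hlinR : (encBlocks Cs.flatten.reverse).length ≤ B * t * (2 * (2 * m * (2 * n)) + 2) := by
    have := length_encBlocks_le (m := m) hn hblkR; rwa [List.length_reverse, hlenCF] at this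
  have hloR : (encBlocks outs.reverse).length ≤ B * (2 * (m * t * (2 * n)) + 2) := by
    have := length_encBlocks_le_of_len hn hovvR; rwa [List.length_reverse, hlouts] at this
  have hlo : (encBlocks outs).length ≤ B * (2 * (m * t * (2 * n)) + 2) := by
    have := length_encBlocks_le_of_len hn hovv'; rwa [hlouts] at this
  have hIF : encBlocks (insts.flatMap fun p => p.1 :: p.2) = encBlocks Cs.flatten.reverse := by rw [hi1, hflat]
  -- the records
  let w1 : GSlots := { w with rr := [], fz := ⟨encBlocks Cs.flatten, [], [], [], [], [], encodeNat t, [], [], [], [], [], [], [], [], []⟩ }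
  let w2 : GSlots := { w with rr := [], fz := ⟨[], encBlocks Cs.flatten.reverse, [], [], [], [], encodeNat t, [], [], [], [], [], [], [], [], []⟩ }
  let w3 : GSlots := { w with rr := [], fz := ⟨encBlocks (insts.flatMap fun p => p.1 :: p.2), [], [], [], [], [], encodeNat t, [], [], [], [], [], [], [], [], []⟩ }
  let w4 : GSlots := { w with rr := [], out := encBlocks outs.reverse, fz := ⟨[], [], [], [], [], [], encodeNat t, [], [], [], [], [], [], [], [], []⟩ }
  let w5 : GSlots := { w with rr := [], out := [], fz := ⟨encBlocks outs.reverse, [], [], [], [], [], encodeNat t, [], [], [], [], [], [], [], [], []⟩ }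
  let w6 : GSlots := { w with rr := [], out := [], fz := ⟨[], encBlocks outs, [], [], [], [], encodeNat t, [], [], [], [], [], [], [], [], []⟩ }
  let w7 : GSlots := { w with rr := encBlocks outs, out := [], fz := ⟨[], [], [], [], [], [], encodeNat t, [], [], [], [], [], [], [], [], []⟩ }
  have h1 : Runs (move (Sum.inr (q .RR)) (Sum.inr (rFG q .IN)) (ra .s)) (base (gSt q T w)) (base (gSt q T w1)) (6 * (B * t * (2 * (2 * m * (2 * n)) + 2)) + 2) := by
    refine (runs_omove (a := q .RR) (b := rFG q .IN) (hgq (by decide)) (gSt q T w)).of_eq ?_ ?_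
    · simp [w1, hrr, hfz]
    · simp only [gSt_RR, hrr]; omega
  have h2 : Runs (revPass (rFG q)) (base (gSt q T w1)) (base (gSt q T w2)) (revPassCost n (2 * m) (B * t)) := by
    have h := runs_revPass (rFG q) hn (gBase q T w1) (by rw [rFG_apply, gBase_v q _ _ (by decide) (by decide)]; exact hW)
      (by rw [rFG_apply, gBase_v q _ _ (by decide) (by decide)]; exact hTT) hblk [] [] [] [] (encodeNat t) [] [] [] [] [] [] [] []
    refine h.of_eq ?_ (by rw [hlenCF])
    simp only [List.append_nil, fSt_gBase, w1, w2]
  have h3 : Runs (move (Sum.inr (rFG q .HOLD)) (Sum.inr (rFG q .IN)) (ra .s)) (base (gSt q T w2)) (base (gSt q T w3)) (6 * (B * t * (2 * (2 * m * (2 * n)) + 2)) + 2) := by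
    refine (runs_omove (a := rFG q .HOLD) (b := rFG q .IN) (hgq (by decide)) (gSt q T w2)).of_eq ?_ ?_
    · simp [w2, w3, hIF]
    · simp only [rFG_apply, gSt_sHOLD, w2]; omega
  have h4 : Runs (oaPass (rFG q)) (base (gSt q T w3)) (base (gSt q T w4)) (oaPassCost n m t B) := by
    have hOI : OAInv (rFG q) N m (gBase q T w3) := by
      refine ⟨?_, by simp [w3, hhnr], ?_, ?_, ?_, ?_, ?_, ?_, ?_, ?_⟩ <;>
        (rw [rFG_apply, gBase_v q _ _ (by decide) (by decide)]; assumption)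
    have h := runs_oaPass (rFG q) hn hmn htn (gBase q T w3) hOI hI1 hI2 [] [] [] rfl
    refine h.of_eq ?_ (by rw [hlinst])
    simp only [rFG_apply, gBase_OUT, hres, w3, hout, List.append_nil, fSt_gBase, update_gSt_fOUT, w4, houts]
  have h5 : Runs (move (Sum.inr (rFG q .OUT)) (Sum.inr (rFG q .IN)) (ra .s)) (base (gSt q T w4)) (base (gSt q T w5)) (6 * (B * (2 * (m * t * (2 * n)) + 2)) + 2) := by
    refine (runs_omove (a := rFG q .OUT) (b := rFG q .IN) (hgq (by decide)) (gSt q T w4)).of_eq ?_ ?_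
    · simp [w4, w5]
    · simp only [rFG_apply, gSt_fOUT, w4]; omega
  have h6 : Runs (revPass (rFG q)) (base (gSt q T w5)) (base (gSt q T w6)) (revPassCost n (m * t) B) := by
    have h := runs_revPass (rFG q) hn (gBase q T w5) (by rw [rFG_apply, gBase_v q _ _ (by decide) (by decide)]; exact hW)
      (by rw [rFG_apply, gBase_v q _ _ (by decide) (by decide)]; exact hTT) hovvR [] [] [] [] (encodeNat t) [] [] [] [] [] [] [] []
    refine h.of_eq ?_ (by rw [List.length_reverse, hlouts])
    simp only [List.append_nil, List.reverse_reverse, fSt_gBase, w5, w6]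
  have h7 : Runs (move (Sum.inr (rFG q .HOLD)) (Sum.inr (q .RR)) (ra .s)) (base (gSt q T w6)) (base (gSt q T w7)) (6 * (B * (2 * (m * t * (2 * n)) + 2)) + 2) := by
    refine (runs_omove (a := rFG q .HOLD) (b := q .RR) (hgq (by decide)) (gSt q T w6)).of_eq ?_ ?_
    · simp [w6, w7]
    · simp only [rFG_apply, gSt_sHOLD, w6]; omega
  refine (h1.seq (h2.seq (h3.seq (h4.seq (h5.seq (h6.seq h7)))))).of_eq (by simp only [w7, hout, hfz, houts]) ?_
  unfold oaRRCost
  have e1 : B * t * (2 * (2 * m * (2 * n)) + 2) = 8 * (B * t * (m * n)) + 2 * (B * t) := by ring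
  have e2 : B * (2 * (m * t * (2 * n)) + 2) = 4 * (B * t * (m * n)) + 2 * B := by ring
  rw [e1, e2]
  omega

/-! ### The per-depth parameters -/

/-- Lengths of small numerals. [folklore] -/
theorem length_encodeNat_le_succ {x j : ℕ} (h : x ≤ 2 ^ j) : (encodeNat x).length ≤ j + 1 := by
  have := Brick.length_encodeNat_mono h
  rw [encodeNat_two_pow] at this
  simpa using this

/-- `x ≤ 2^x`. [folklore] -/
theorem le_two_pow_self (x : ℕ) : x ≤ 2 ^ x := Nat.lt_two_pow_self.le

/-- Compute the parameters of exponent `k` (in `KN`): `AR := a = ⌈k/2⌉`, `LVN := lv = ⌊k/2⌋`,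
`LVU := 1^{lv}`, `MREG := m = 2^a`, `TREG := t = 2^{lv}`, and the pass constants `HN := m`,
`M2 := LEN := 2m`, `M4 := 4m`. [folklore] -/
def setParams : Com (EReg ⊕ β) :=
  (NS.ofList [.succ (q .KD) (q .KN), .const (q .TREG) (encodeNat 2), .divMod (q .AR) (q .MREG) (q .KD) (q .TREG),
     .clear (q .MREG), .divMod (q .LVN) (q .MREG) (q .KN) (q .TREG), .clear (q .MREG), .clear (q .KD), .clear (q .TREG),
     .toUnary (q .LVU) (q .LVN)] : NS β).com ;;
  (pow2Into q (q .MREG) (q .AR) ;; (pow2Into q (q .TREG) (q .LVN) ;;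
  (NS.ofList [.copy (q .MREG) (q (.f .HN)), .copy (q .MREG) (q (.f .M2)), .push (q (.f .M2)) false,
     .copy (q (.f .M2)) (q (.f .M4)), .push (q (.f .M4)) false, .copy (q (.f .M2)) (q (.f (.n (.v .LEN))))] : NS β).com))

/-- Cost of `setParams`. [folklore] -/
def setParamsCost (n k : ℕ) : ℕ := 897 * (n + 1) ^ 3 + 2 * (n * (16 * k + 21) + 3 * k + 7)

/-- The driver record with the parameters of exponent `k` set. [folklore] -/
def GSlots.withParams (w : GSlots) (k : ℕ) : GSlots :=
  { w with ar := encodeNat ((k + 1) / 2), lvn := encodeNat (k / 2), lvu := List.replicate (k / 2) true, mreg := encodeNat (2 ^ ((k + 1) / 2)), treg := encodeNat (2 ^ (k / 2)), hn := encodeNat (2 ^ ((k + 1) / 2)), m2 := encodeNat (2 * 2 ^ ((k + 1) / 2)), m4 := encodeNat (4 * 2 ^ ((k + 1) / 2)), len := encodeNat (2 * 2 ^ ((k + 1) / 2)) }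

/-- **`setParams`.** [folklore] -/
theorem runs_setParams {N k n : ℕ} (hkn : k + 2 ≤ n) (T : Regs β) (hI : DrvInv q N T) (w : GSlots)
    (hkn' : w.kn = encodeNat k) (hkd : w.kd = []) (har : w.ar = []) (hlvn : w.lvn = []) (hlvu : w.lvu = []) (hmreg : w.mreg = [])
    (htreg : w.treg = []) (hhn : w.hn = []) (hm2 : w.m2 = []) (hm4 : w.m4 = []) (hlen : w.len = []) :
    Runs (setParams q) (base (gSt q T w)) (base (gSt q T (w.withParams k))) (setParamsCost n k) := by
  have hgq : ∀ {i j : GReg}, i ≠ j → q i ≠ q j := fun h => gq_ne q h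
  have hU : T (q (.f (.n (.v .U)))) = [] := hI.2.2.2.2.2.2.2.2.2.2.1
  set a := (k + 1) / 2 with ha
  set lv := k / 2 with hlv
  set m := 2 ^ a with hm
  set t := 2 ^ lv with ht
  set c := (n + 1) ^ 3 with hc3
  have hm0 : 0 < m := Nat.two_pow_pos a
  have e2 : encodeNat (2 * m) = false :: encodeNat m := encodeNat_two_mul _ hm0
  have e4 : encodeNat (4 * m) = false :: false :: encodeNat m := by
    rw [show 4 * m = 2 * (2 * m) by ring, encodeNat_two_mul _ (by omega), e2]
  have hl : ∀ x, x ≤ k + 1 → (encodeNat x).length ≤ n := fun x hx =>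
    (length_encodeNat_le_succ (hx.trans (le_two_pow_self _))).trans (by omega)
  have hla : (encodeNat a).length ≤ n := hl a (by omega)
  have hllv : (encodeNat lv).length ≤ n := hl lv (by omega)
  have hlm : (encodeNat m).length ≤ n := by rw [hm, encodeNat_two_pow]; simp; omega
  have hlt : (encodeNat t).length ≤ n := by rw [ht, encodeNat_two_pow]; simp; omega
  have hl2 : (encodeNat 2).length ≤ n := (length_encodeNat_le_succ (show 2 ≤ 2 ^ 1 by norm_num)).trans (by omega)
  -- records
  let w1 : GSlots := { w with ar := encodeNat a, lvn := encodeNat lv, lvu := List.replicate lv true }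
  let w2 : GSlots := { w with ar := encodeNat a, lvn := encodeNat lv, lvu := List.replicate lv true, mreg := encodeNat m }
  let w3 : GSlots := { w with ar := encodeNat a, lvn := encodeNat lv, lvu := List.replicate lv true, mreg := encodeNat m, treg := encodeNat t }
  have h1 : Runs (NS.ofList [.succ (q .KD) (q .KN), .const (q .TREG) (encodeNat 2), .divMod (q .AR) (q .MREG) (q .KD) (q .TREG),
      .clear (q .MREG), .divMod (q .LVN) (q .MREG) (q .KN) (q .TREG), .clear (q .MREG), .clear (q .KD), .clear (q .TREG),
      .toUnary (q .LVU) (q .LVN)] : NS β).com (base (gSt q T w)) (base (gSt q T w1)) (830 * c) := by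
    refine NS.runs_of_eq (N := n) _ _ ?_ ?_ (by simp [hc3])
    · simp only [NS.ofList, NS.ok, NOp.ok, NS.eval, NOp.eval, gSt_KN, gSt_KD, gSt_TREG, gSt_AR, gSt_MREG, gSt_LVN, gSt_LVU,
        update_gSt_KD, update_gSt_TREG, update_gSt_AR, update_gSt_MREG, update_gSt_LVN,
        hkn', hkd, har, hlvn, hlvu, hmreg, htreg, bitsToNat_encodeNat, List.length_nil, ne_eq, EmbeddingLike.apply_eq_iff_eq]
      have hsm : ∀ x, x < 2 → (encodeNat x).length ≤ n := fun x hx =>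
        (length_encodeNat_le_succ (show x ≤ 2 ^ 1 by norm_num; omega)).trans (by omega)
      have hm1 : (encodeNat ((k + 1) % 2)).length ≤ n := hsm _ (Nat.mod_lt _ (by decide))
      have hm2' : (encodeNat (k % 2)).length ≤ n := hsm _ (Nat.mod_lt _ (by decide))
      exact ⟨⟨hl k (by omega), by omega⟩, ⟨by omega, hl2⟩, ⟨by decide, by decide, by decide, by decide, by decide, hl (k + 1) le_rfl, hl2,
        by omega, by omega, by decide⟩, hm1, ⟨by decide, by decide, by decide, by decide, by decide, hl k (by omega), hl2, by omega,
        by omega, by decide⟩, hm2', hl (k + 1) le_rfl, hl2, ⟨trivial, hllv, by omega⟩, trivial⟩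
    · simp [w1, hkn', hkd, har, hlvn, hlvu, hmreg, htreg, ha, hlv]
  have h2 : Runs (pow2Into q (q .MREG) (q .AR)) (base (gSt q T w1)) (base (gSt q T w2)) (n * (16 * a + 21) + 3 * a + 7) := by
    refine (runs_pow2Into q (hgq (by decide)) (hgq (by decide)) hla (gSt q T w1) (by simp [w1]) (by simp [w1, hmreg])
      (by simp [gSt_v q T w1, hU])).of_eq ?_ le_rfl
    simp [w1, w2, hm]
  have h3 : Runs (pow2Into q (q .TREG) (q .LVN)) (base (gSt q T w2)) (base (gSt q T w3)) (n * (16 * lv + 21) + 3 * lv + 7) := by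
    refine (runs_pow2Into q (hgq (by decide)) (hgq (by decide)) hllv (gSt q T w2) (by simp [w2]) (by simp [w2, htreg])
      (by simp [gSt_v q T w2, hU])).of_eq ?_ le_rfl
    simp [w2, w3, ht]
  have h4 : Runs (NS.ofList [.copy (q .MREG) (q (.f .HN)), .copy (q .MREG) (q (.f .M2)), .push (q (.f .M2)) false,
      .copy (q (.f .M2)) (q (.f .M4)), .push (q (.f .M4)) false, .copy (q (.f .M2)) (q (.f (.n (.v .LEN))))] : NS β).com
      (base (gSt q T w3)) (base (gSt q T (w.withParams k))) (54 * c) := by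
    refine NS.runs_of_eq (N := n) _ _ ?_ ?_ (by simp [hc3])
    · simp only [NS.ofList, NS.ok, NOp.ok, NS.eval, NOp.eval, gSt_MREG, gSt_fHN, gSt_fM2, gSt_fM4,
        update_gSt_fHN, update_gSt_fM2, update_gSt_fM4, w3, hhn, hm2, hm4, hlen, List.append_nil,
        List.length_cons, ne_eq, EmbeddingLike.apply_eq_iff_eq]
      have hlm' : (encodeNat m).length + 1 ≤ n := by rw [hm, encodeNat_two_pow]; simp; omega
      exact ⟨⟨by decide, hlm⟩, ⟨by decide, hlm⟩, trivial, ⟨by decide, hlm'⟩, trivial, ⟨by decide, hlm'⟩, trivial⟩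
    · simp [w3, GSlots.withParams, hhn, hm2, hm4, hlen, ← ha, ← hlv, ← hm, ← ht, e2, e4]
  refine (h1.seq (h2.seq (h3.seq h4))).of_eq rfl ?_
  unfold setParamsCost
  have ha' : a ≤ k := by omega
  have hlv' : lv ≤ k := by omega
  nlinarith [Nat.zero_le (n * a), Nat.zero_le (n * lv), Nat.mul_le_mul_left n ha', Nat.mul_le_mul_left n hlv']

/-! ### The descent step -/

/-- Prepending an item codes a longer list. [folklore] -/
theorem dbl_append_encList (a : List Bool) (l : List (List Bool)) : dbl a ++ [false, true] ++ encList l = encList (a :: l) := by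
  rw [encList_cons, boolPair, dbl, List.append_assoc]

/-- The first part of the descent step: schedule the exponent, set the parameters, digitize both
batches (`BG` first, its root twiddles to `TW2`; then `BF`, twiddles to `TW`), and load `HN := t`
for the level loop. [folklore] -/
def descA : Com (EReg ⊕ β) :=
  (NS.op (.copy (q .KN) (q .KD)) : NS β).com ;; (prependItem q (q .KD) (q .SCHED) ;; (setParams q ;;
  ((NS.op (.copy (q .TREG) (q (.f .T1))) : NS β).com ;; (digitBG q ;; (digitBF q ;;
  (NS.ofList [.clear (q (.f .T1)), .clear (q (.f .HN)), .copy (q .TREG) (q (.f .HN))] : NS β).com)))))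

/-- Cost of `descA` on `B` blocks at exponent `k`. [folklore] -/
def descACost (n k B : ℕ) : ℕ :=
  45 * (n + 1) ^ 3 + 10 * n + 10 + setParamsCost n k + 2 * digitCost n (2 ^ ((k + 1) / 2)) (2 ^ (k / 2)) B

/-- The driver record at level `j` of the descent at exponent `k` started from `w` on the batches
`Fb`, `Gb`. [folklore] -/
def GSlots.descAt (w : GSlots) (N k : ℕ) (Fb Gb : List (List ℕ)) (j : ℕ) : GSlots :=
  { w with kd := [], sched := dbl (encodeNat k) ++ [false, true] ++ w.sched, ar := encodeNat ((k + 1) / 2), lvn := encodeNat (k / 2), lvu := List.replicate (k / 2 - j) true, mreg := encodeNat (2 ^ ((k + 1) / 2)), treg := encodeNat (2 ^ (k / 2)), hn := encodeNat (2 ^ (k / 2 - j)), m2 := encodeNat (2 * 2 ^ ((k + 1) / 2)), m4 := encodeNat (4 * 2 ^ ((k + 1) / 2)), len := encodeNat (2 * 2 ^ ((k + 1) / 2)), bf := encBlocks (NegFFT.dLevel N k Fb j), bg := encBlocks (NegFFT.dLevel N k Gb j), tw2 := encVec (NegFFT.twAt (2 ^ ((k + 1) / 2)) (2 * 2 ^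 ((k + 1) / 2)) Fb.length j), hist := encList ((NegFFT.twHist (2 ^ ((k + 1) / 2)) (2 * 2 ^ ((k + 1) / 2)) Fb.length j).map encVec) ++ w.hist, fz := { w.fz with tw := encVec (NegFFT.twAt (2 ^ ((k + 1) / 2)) (2 * 2 ^ ((k + 1) / 2)) Fb.length j) } }

/-- **`descA`.** [folklore] -/
theorem runs_descA {N k n : ℕ} (hn : (encodeNat N).length + 1 ≤ n) (hkn : k + 4 ≤ n) (T : Regs β) (hI : DrvInv q N T)
    (w : GSlots) {Fb Gb : List (List ℕ)} (hFb : ∀ b ∈ Fb, NegFFT.BlockOK N (2 ^ k) b) (hGb : ∀ b ∈ Gb, NegFFT.BlockOK N (2 ^ k) b)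
    (hBG : Gb.length = Fb.length)
    (hkn' : w.kn = encodeNat k) (hbf : w.bf = encBlocks Fb) (hbg : w.bg = encBlocks Gb)
    (hkd : w.kd = []) (har : w.ar = []) (hlvn : w.lvn = []) (hlvu : w.lvu = []) (hmreg : w.mreg = []) (htreg : w.treg = [])
    (hhn : w.hn = []) (hm2 : w.m2 = []) (hm4 : w.m4 = []) (hlen : w.len = []) (htw2 : w.tw2 = []) (htmph : w.tmph = [])
    (hout : w.out = []) (htwout : w.twout = []) (hfz : w.fz = ⟨[], [], [], [], [], [], [], [], [], [], [], [], [], [], [], []⟩) :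
    Runs (descA q) (base (gSt q T w)) (base (gSt q T (w.descAt N k Fb Gb 0))) (descACost n k Fb.length) := by
  have hgq : ∀ {i j : GReg}, i ≠ j → q i ≠ q j := fun h => gq_ne q h
  set a := (k + 1) / 2 with ha
  set lv := k / 2 with hlv
  set m := 2 ^ a with hm
  set t := 2 ^ lv with ht
  set c := (n + 1) ^ 3 with hc3
  set B := Fb.length with hB
  have hK : 2 ^ k = m * t := NegFFT.two_pow_split k
  have hm0 : 0 < m := Nat.two_pow_pos a
  have hlk : (encodeNat k).length ≤ n := (length_encodeNat_le_succ (le_two_pow_self k)).trans (by omega)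
  have hlm : (encodeNat m).length ≤ n := by rw [hm, encodeNat_two_pow]; simp; omega
  have hlt : (encodeNat t).length ≤ n := by rw [ht, encodeNat_two_pow]; simp; omega
  have hm2n : (encodeNat (2 * m)).length + 1 ≤ n := by rw [hm, ← pow_succ', encodeNat_two_pow]; simp; omega
  have hFb' : ∀ b ∈ Fb, (∀ x ∈ b, x < N) ∧ b.length = m * t := fun b hb => ⟨(hFb b hb).2, by rw [(hFb b hb).1, hK]⟩
  have hGb' : ∀ b ∈ Gb, (∀ x ∈ b, x < N) ∧ b.length = m * t := fun b hb => ⟨(hGb b hb).2, by rw [(hGb b hb).1, hK]⟩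
  -- records
  let w1 : GSlots := { w with kd := encodeNat k }
  let w2 : GSlots := { w with kd := [], sched := dbl (encodeNat k) ++ [false, true] ++ w.sched }
  let w3 : GSlots := w2.withParams k
  let w4 : GSlots := { w3 with fz := ⟨[], [], [], [], [], [], encodeNat t, [], [], [], [], [], [], [], [], []⟩ }
  let w5 : GSlots := { w3 with bg := encBlocks (Gb.flatMap (chunksPad m t)), tw2 := encVec (List.replicate Gb.length (2 * m)) ++ w3.tw2, fz := ⟨[], [], [], [], [], [], encodeNat t, [], [], [], [], [], [], [], [], []⟩ }
  let w6 : GSlots := { w5 with bf := encBlocks (Fb.flatMap (chunksPad m t)), fz := ⟨[], [], [], [], encVec (List.replicate Fb.length (2 * m)), [], encodeNat t, [], [], [], [], [], [], [], [], []⟩ }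
  have h1 : Runs (NS.op (.copy (q .KN) (q .KD)) : NS β).com (base (gSt q T w)) (base (gSt q T w1)) (13 * c) :=
    NS.runs_of_eq (N := n) _ _ (by simp [NOp.ok, hkn', hlk, hgq]) (by simp [w1, hkn', hkd]) (by simp [hc3])
  have h2 : Runs (prependItem q (q .KD) (q .SCHED)) (base (gSt q T w1)) (base (gSt q T w2)) (10 * n + 10) := by
    refine (runs_prependItem q (src := q .KD) (dst := q .SCHED) (hgq (by decide)) (hgq (by decide)) (hgq (by decide)) (gSt q T w1)
      (by simp [w1, htmph])).of_eq ?_ ?_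
    · simp [w1, w2]
    · simp only [gSt_KD, w1]; omega
  have h3 : Runs (setParams q) (base (gSt q T w2)) (base (gSt q T w3)) (setParamsCost n k) :=
    runs_setParams q (by omega) T hI w2 (by simp [w2, hkn']) rfl (by simp [w2, har]) (by simp [w2, hlvn]) (by simp [w2, hlvu])
      (by simp [w2, hmreg]) (by simp [w2, htreg]) (by simp [w2, hhn]) (by simp [w2, hm2]) (by simp [w2, hm4]) (by simp [w2, hlen])
  have h4 : Runs (NS.op (.copy (q .TREG) (q (.f .T1))) : NS β).com (base (gSt q T w3)) (base (gSt q T w4)) (13 * c) :=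
    NS.runs_of_eq (N := n) _ _ (by simp [NOp.ok, w3, w2, GSlots.withParams, ← hlv, ← ht, hlt, hgq])
      (by simp [w3, w4, w2, GSlots.withParams, hfz, ← hlv, ← ht]) (by simp [hc3])
  have h5 : Runs (digitBG q) (base (gSt q T w4)) (base (gSt q T w5)) (digitCost n m t Gb.length) := by
    have h := runs_digitBG q hn hlm hm2n hlt T hI w4 hGb' (by simp [w4, w3, w2, GSlots.withParams, hbg])
      (by simp [w4, w3, w2, GSlots.withParams, ← ha, ← hm]) (by simp [w4, w3, w2, GSlots.withParams, ← ha, ← hm]) (by simp [w4, w3, w2, GSlots.withParams, hout])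
      (by simp [w4, w3, w2, GSlots.withParams, htwout]) [] [] [] [] [] [] [] rfl
    exact h.of_eq (by simp only [w4, w5]) le_rfl
  have h6 : Runs (digitBF q) (base (gSt q T w5)) (base (gSt q T w6)) (digitCost n m t B) := by
    have h := runs_digitBF q hn hlm hm2n hlt T hI w5 hFb' (by simp [w5, w3, w2, GSlots.withParams, hbf])
      (by simp [w5, w3, w2, GSlots.withParams, ← ha, ← hm]) (by simp [w5, w3, w2, GSlots.withParams, ← ha, ← hm]) (by simp [w5, w3, w2, GSlots.withParams, hout])
      (by simp [w5, w3, w2, GSlots.withParams, htwout]) [] [] [] [] [] [] [] rfl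
    exact h.of_eq (by simp only [w5, w6]) le_rfl
  have h7 : Runs (NS.ofList [.clear (q (.f .T1)), .clear (q (.f .HN)), .copy (q .TREG) (q (.f .HN))] : NS β).com (base (gSt q T w6))
      (base (gSt q T (w.descAt N k Fb Gb 0))) (19 * c) := by
    refine NS.runs_of_eq (N := n) _ _ ?_ ?_ (by simp [hc3])
    · simp [NOp.ok, w6, w5, w3, w2, GSlots.withParams, ← ha, ← hm, ← hlv, ← ht, hlt, hlm, hgq]
    · have e1 : Fb.flatMap (chunksPad m t) = NegFFT.dLevel N k Fb 0 := by
        rw [NegFFT.dLevel_zero, ← hm, ← ht]; congr 1; funext b; exact chunksPad_eq_digits m t b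
      have e2 : Gb.flatMap (chunksPad m t) = NegFFT.dLevel N k Gb 0 := by
        rw [NegFFT.dLevel_zero, ← hm, ← ht]; congr 1; funext b; exact chunksPad_eq_digits m t b
      simp [w6, w5, w3, w2, GSlots.withParams, GSlots.descAt, NegFFT.twAt, hfz, htw2, hBG, ← ha, ← hm, ← hlv, ← ht, e1, e2, hB]
  refine (h1.seq (h2.seq (h3.seq (h4.seq (h5.seq (h6.seq h7)))))).of_eq rfl ?_
  unfold descACost
  rw [hBG, ← ha, ← hlv, ← hm, ← ht]
  omega

/-! ### The forward level loop of the descent -/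

/-- A uniform bound for the wrapped level passes in terms of `P = h · |Fs|` (half the number of
blocks, constant along a descent). [folklore] -/
def lvlBound (cP n m P : ℕ) : ℕ := P * (cP + 464 * (m * n) + 206 * n + 200 * (n + 1) ^ 3 + 230) + 18

/-- The level-pass cost is linear in the data. [folklore] -/
theorem levelCost_le (cP n m h nF : ℕ) (hh : 1 ≤ h) :
    levelCost cP n m h nF ≤ h * nF * (cP + 272 * (m * n) + 104 * n + 200 * (n + 1) ^ 3 + 80) + 6 := by
  unfold levelCost segCost
  have hnF : nF * (56 * n + 200 * (n + 1) ^ 3 + 34) ≤ h * nF * (56 * n + 200 * (n + 1) ^ 3 + 34) :=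
    Nat.mul_le_mul_right _ (Nat.le_mul_of_pos_left nF hh)
  nlinarith [hnF]

/-- The wrapped level passes within `lvlBound`. [folklore] -/
theorem lvlCost_le (cP n m h nF : ℕ) (hh : 1 ≤ h) : lvlCost cP n m h nF + 78 * (nF * (n + 1)) + 6 ≤ lvlBound cP n m (h * nF) := by
  unfold lvlCost lvlBound
  have h1 := levelCost_le cP n m h nF hh
  have hnF : nF ≤ h * nF := Nat.le_mul_of_pos_left nF hh
  have h2 : nF * (102 * n + 102) ≤ h * nF * (102 * n + 102) := Nat.mul_le_mul_right _ hnF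
  nlinarith [h1, h2]

/-- One round of the forward level loop: halve `HN`, save the parent twiddles on `HIST`, run the
level on `BG` then on `BF`. [folklore] -/
def lvBody : Com (EReg ⊕ β) :=
  (NS.op (.drop (q (.f .HN))) : NS β).com ;; (copy (Sum.inr (rFG q .TW)) (Sum.inr (q .TW3)) (ra .t) (ra .u) ;;
  (prependItem q (q .TW3) (q .HIST) ;; (lvlBG q ;; lvlBF q)))

/-- Cost of one round of the level loop (`P = B · 2^{lv-1}`). [folklore] -/
def lvIterCost (n m P : ℕ) : ℕ := 2 * lvlBound (pairCost n m) n m P + 40 * (P * (n + 1)) + 2 * (n + 1) ^ 3 + 13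

/-- **One round of the level loop**, from level `j < lv` to level `j + 1`. [folklore] -/
theorem runs_lvBody {N k n : ℕ} (hN : 0 < N) (hn : (encodeNat N).length + 1 ≤ n) (hkn : k + 4 ≤ n) (T : Regs β) (hI : DrvInv q N T)
    (w : GSlots) {Fb Gb : List (List ℕ)} (hFb : ∀ b ∈ Fb, NegFFT.BlockOK N (2 ^ k) b) (hGb : ∀ b ∈ Gb, NegFFT.BlockOK N (2 ^ k) b)
    (hBG : Gb.length = Fb.length) (htws : w.tws = []) (htw3 : w.tw3 = []) (htmph : w.tmph = []) (hout : w.out = []) (htwout : w.twout = [])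
    (hfz : w.fz = ⟨[], [], [], [], [], [], [], [], [], [], [], [], [], [], [], []⟩) {j : ℕ} (hj : j < k / 2) :
    Runs (lvBody q) (base (gSt q T { w.descAt N k Fb Gb j with lvu := List.replicate (k / 2 - (j + 1)) true }))
      (base (gSt q T (w.descAt N k Fb Gb (j + 1)))) (lvIterCost n (2 ^ ((k + 1) / 2)) (Fb.length * 2 ^ (k / 2 - 1))) := by
  have hgq : ∀ {i j : GReg}, i ≠ j → q i ≠ q j := fun h => gq_ne q h
  set a := (k + 1) / 2 with ha
  set lv := k / 2 with hlv
  set m := 2 ^ a with hm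
  set c := (n + 1) ^ 3 with hc3
  set B := Fb.length with hB
  set h := 2 ^ (lv - (j + 1)) with hh
  set Fs := NegFFT.twAt m (2 * m) B j with hFs0
  set Bs := NegFFT.dLevel N k Fb j with hBs0
  set Cs := NegFFT.dLevel N k Gb j with hCs0
  set nF := Fs.length with hnF
  have hm0 : 0 < m := Nat.two_pow_pos a
  have hja : j < a := by omega
  have hFs : ∀ F ∈ Fs, F = 2 * (F / 2) ∧ 1 ≤ F / 2 ∧ F / 2 < 4 * m := NegFFT.twAt_hFs a B hja
  have hBs : ∀ b ∈ Bs, b.length = 2 * m ∧ ∀ x ∈ b, x < N := NegFFT.dLevel_valid N k Fb hN hFb j hj.le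
  have hCs : ∀ b ∈ Cs, b.length = 2 * m ∧ ∀ x ∈ b, x < N := NegFFT.dLevel_valid N k Gb hN hGb j hj.le
  have hlFs : nF = B * 2 ^ j := NegFFT.length_twAt m (2 * m) B j
  have h2h : 2 * h * 2 ^ j = 2 ^ lv := by rw [hh, ← pow_succ', ← pow_add]; congr 1; omega
  have hP : h * nF = B * 2 ^ (lv - 1) := by
    rw [hlFs, hh, mul_left_comm, ← pow_add]; congr 2; omega
  have hlenB : Bs.length = 2 * h * nF := by
    rw [hBs0, NegFFT.length_dLevel N k Fb hj.le, ← hB, ← hlv, ← h2h, hlFs]; ring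
  have hlenC : Cs.length = 2 * h * nF := by
    rw [hCs0, NegFFT.length_dLevel N k Gb hj.le, hBG, ← hlv, ← h2h, hlFs]; ring
  have hm4n : (encodeNat (4 * m)).length + 1 ≤ n := by
    rw [hm, show 4 * 2 ^ a = 2 ^ (a + 2) by rw [pow_add]; ring, encodeNat_two_pow]; simp; omega
  have hhn : (encodeNat h).length ≤ n := by rw [hh, encodeNat_two_pow]; simp; omega
  have hlF : (encVec Fs).length ≤ nF * (2 * (n + 1)) := by
    have hct : ∀ x ∈ Fs, x < 4 * m + 4 * m := fun F hF => by have := hFs F hF; omega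
    have h8 : (encodeNat (4 * m + 4 * m)).length + 1 ≤ n + 1 := by
      rw [hm, show 4 * 2 ^ a + 4 * 2 ^ a = 2 ^ (a + 3) by rw [pow_add]; ring, encodeNat_two_pow]; simp; omega
    exact length_encVec_le_of_lt hct h8
  have hh1 : 1 ≤ h := Nat.one_le_two_pow
  -- the halving of `HN`
  have eHN : encodeNat (2 ^ (lv - j)) = false :: encodeNat h := by
    rw [show lv - j = lv - (j + 1) + 1 by omega, pow_succ, mul_comm]; exact encodeNat_two_mul _ (Nat.two_pow_pos _)
  -- records
  let v0 : GSlots := { w.descAt N k Fb Gb j with lvu := List.replicate (lv - (j + 1)) true }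
  let v1 : GSlots := { v0 with hn := encodeNat h }
  let v2 : GSlots := { v1 with tw3 := encVec Fs }
  let v3 : GSlots := { v2 with tw3 := [], hist := dbl (encVec Fs) ++ [false, true] ++ v0.hist }
  let v4 : GSlots := { v3 with bg := encBlocks (levelOut (NegFFT.gF₁ N m) (NegFFT.gF₂ N m) h Fs Cs), tw2 := encVec (childTw m Fs), fz := ⟨[], [], [], [], encVec Fs, [], [], [], [], [], [], [], [], [], [], []⟩ }
  let v5 : GSlots := { v4 with bf := encBlocks (levelOut (NegFFT.gF₁ N m) (NegFFT.gF₂ N m) h Fs Bs), fz := ⟨[], [], [], [], encVec (childTw m Fs), [], [], [], [], [], [], [], [], [], [], []⟩ }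
  have h1 : Runs (NS.op (.drop (q (.f .HN))) : NS β).com (base (gSt q T v0)) (base (gSt q T v1)) (2 * c) :=
    NS.runs_of_eq (N := n) _ _ (by simp [NOp.ok]) (by simp [v0, v1, GSlots.descAt, ← hlv, eHN]) (by simp [hc3])
  have h2 : Runs (copy (Sum.inr (rFG q .TW)) (Sum.inr (q .TW3)) (ra .t) (ra .u)) (base (gSt q T v1)) (base (gSt q T v2))
      (10 * (nF * (2 * (n + 1))) + 3) := by
    refine (runs_ocopy (a := rFG q .TW) (b := q .TW3) (hgq (by decide)) (gSt q T v1)).of_eq ?_ ?_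
    · simp [v1, v0, v2, GSlots.descAt, hfz, htw3, hFs0, ← ha, ← hm, ← hB]
    · simp only [rFG_apply, gSt_sTW, v1, v0, GSlots.descAt, hfz, ← hFs0, ← ha, ← hm, ← hB]; omega
  have h3 : Runs (prependItem q (q .TW3) (q .HIST)) (base (gSt q T v2)) (base (gSt q T v3)) (10 * (nF * (2 * (n + 1))) + 10) := by
    refine (runs_prependItem q (src := q .TW3) (dst := q .HIST) (hgq (by decide)) (hgq (by decide)) (hgq (by decide)) (gSt q T v2)
      (by simp [v2, v1, v0, GSlots.descAt, htmph])).of_eq ?_ ?_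
    · simp [v2, v3, v1]
    · simp only [gSt_TW3, v2]; omega
  have h4 : Runs (lvlBG q) (base (gSt q T v3)) (base (gSt q T v4)) (lvlCost (pairCost n m) n m h nF + 48 * (nF * (n + 1)) + 30 * (nF * (n + 1)) + 6) := by
    have hr := runs_lvlBG q hn hm4n hhn T hI v3 hFs hCs hlenC Fs (by nlinarith [hlF]) (by simp [v3, v2, v1, v0, GSlots.descAt, hCs0])
      (by simp [v3, v2, v1, v0, GSlots.descAt, hFs0, ← ha, ← hm, ← hB]) (by simp [v3, v2, v1, v0, GSlots.descAt, htws])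
      (by simp [v3, v2, v1]) (by simp [v3, v2, v1, v0, GSlots.descAt, ← ha, ← hm]) (by simp [v3, v2, v1, v0, GSlots.descAt, ← ha, ← hm])
      (by simp [v3, v2, v1, v0, GSlots.descAt, ← ha, ← hm]) (by simp [v3, v2, v1, v0, GSlots.descAt, hout])
      (by simp [v3, v2, v1, v0, GSlots.descAt, htwout]) (by simp [v3, v2, v1, v0, GSlots.descAt, hfz, hFs0, ← ha, ← hm, ← hB])
    exact hr.of_eq (by simp only [v3, v4]) (by rw [hnF])
  have h5 : Runs (lvlBF q) (base (gSt q T v4)) (base (gSt q T v5)) (lvlCost (pairCost n m) n m h nF) := by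
    have hr := runs_lvlBF q hn hm4n hhn T hI v4 hFs hBs hlenB (by simp [v4, v3, v2, v1, v0, GSlots.descAt, hBs0])
      (by simp [v4, v3, v2, v1]) (by simp [v4, v3, v2, v1, v0, GSlots.descAt, ← ha, ← hm]) (by simp [v4, v3, v2, v1, v0, GSlots.descAt, ← ha, ← hm])
      (by simp [v4, v3, v2, v1, v0, GSlots.descAt, ← ha, ← hm]) (by simp [v4, v3, v2, v1, v0, GSlots.descAt, hout])
      (by simp [v4, v3, v2, v1, v0, GSlots.descAt, htwout]) (by simp [v4])
    exact hr.of_eq (by simp only [v4, v5]) (by rw [hnF])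
  -- the final record is level `j + 1`
  have eBs : levelOut (NegFFT.gF₁ N m) (NegFFT.gF₂ N m) h Fs Bs = NegFFT.dLevel N k Fb (j + 1) := by
    rw [hBs0, hFs0, hh, hm, hB, hlv, ha]; exact NegFFT.levelOut_dLevel N k Fb hj
  have eCs : levelOut (NegFFT.gF₁ N m) (NegFFT.gF₂ N m) h Fs Cs = NegFFT.dLevel N k Gb (j + 1) := by
    rw [hCs0, hFs0, hh, hm, ← hBG, hlv, ha]; exact NegFFT.levelOut_dLevel N k Gb hj
  have eTw : childTw m Fs = NegFFT.twAt m (2 * m) B (j + 1) := by rw [hFs0, NegFFT.twAt_succ]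
  have eH : dbl (encVec Fs) ++ [false, true] ++ (encList ((NegFFT.twHist m (2 * m) B j).map encVec) ++ w.hist) =
      encList ((NegFFT.twHist m (2 * m) B (j + 1)).map encVec) ++ w.hist := by
    rw [NegFFT.twHist_succ, List.map_cons, ← dbl_append_encList, hFs0]; simp only [List.append_assoc]
  refine (h1.seq (h2.seq (h3.seq (h4.seq h5)))).of_eq ?_ ?_
  · simp only [v5, v4, v3, v2, v1, v0, GSlots.descAt, ← ha, ← hlv, ← hm, ← hB, ← hh, eBs, eCs, eTw, eH, hfz, htw3]
  · have hb := lvlCost_le (pairCost n m) n m h nF hh1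
    rw [hP] at hb
    unfold lvIterCost
    have hnP : nF * (n + 1) ≤ B * 2 ^ (lv - 1) * (n + 1) :=
      Nat.mul_le_mul_right (n + 1) (show nF ≤ B * 2 ^ (lv - 1) by rw [← hP]; exact Nat.le_mul_of_pos_left nF hh1)
    have hX : 10 * (nF * (2 * (n + 1))) ≤ 20 * (B * 2 ^ (lv - 1) * (n + 1)) := by
      calc 10 * (nF * (2 * (n + 1))) = 20 * (nF * (n + 1)) := by ring
        _ ≤ 20 * (B * 2 ^ (lv - 1) * (n + 1)) := by omega
    omega

/-! ### The descent step -/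

/-- The cleanup after the level loop: discard the leaf twiddles, clear the parameters, and set the
next exponent `KN := a + 1`. [folklore] -/
def descC : Com (EReg ⊕ β) :=
  clear (Sum.inr (rFG q .TW)) ;; (clear (Sum.inr (q .TW2)) ;;
  (NS.ofList [.clear (q (.f .HN)), .clear (q (.f .M2)), .clear (q (.f .M4)), .clear (q (.f (.n (.v .LEN)))), .clear (q .MREG),
    .clear (q .TREG), .clear (q .LVN), .clear (q .KN), .succ (q .KN) (q .AR), .clear (q .AR)] : NS β).com)

/-- Cost of `descC`. [folklore] -/
def descCCost (n k B : ℕ) : ℕ := 4 * (B * 2 ^ (k / 2) * (2 * (n + 1))) + 2 + 99 * (n + 1) ^ 3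

/-- The driver record after the descent step at exponent `k` from `w`. [folklore] -/
def GSlots.descEnd (w : GSlots) (N k : ℕ) (Fb Gb : List (List ℕ)) : GSlots :=
  { w with kn := encodeNat ((k + 1) / 2 + 1), sched := dbl (encodeNat k) ++ [false, true] ++ w.sched, bf := encBlocks (NegFFT.descOne N k Fb), bg := encBlocks (NegFFT.descOne N k Gb), hist := encList ((NegFFT.twHist (2 ^ ((k + 1) / 2)) (2 * 2 ^ ((k + 1) / 2)) Fb.length (k / 2)).map encVec) ++ w.hist }

/-- **`descC`.** [folklore] -/
theorem runs_descC {N k n : ℕ} (hkn : k + 4 ≤ n) (T : Regs β) (w : GSlots) {Fb Gb : List (List ℕ)} (hkn' : w.kn = encodeNat k)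
    (hkd : w.kd = []) (har : w.ar = []) (hlvn : w.lvn = []) (hlvu : w.lvu = []) (hmreg : w.mreg = []) (htreg : w.treg = [])
    (hhn : w.hn = []) (hm2 : w.m2 = []) (hm4 : w.m4 = []) (hlen : w.len = []) (htw2 : w.tw2 = [])
    (hfz : w.fz = ⟨[], [], [], [], [], [], [], [], [], [], [], [], [], [], [], []⟩) :
    Runs (descC q) (base (gSt q T (w.descAt N k Fb Gb (k / 2)))) (base (gSt q T (w.descEnd N k Fb Gb))) (descCCost n k Fb.length) := by
  have hgq : ∀ {i j : GReg}, i ≠ j → q i ≠ q j := fun h => gq_ne q h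
  set a := (k + 1) / 2 with ha
  set lv := k / 2 with hlv
  set m := 2 ^ a with hm
  set c := (n + 1) ^ 3 with hc3
  set B := Fb.length with hB
  set Fs := NegFFT.twAt m (2 * m) B lv with hFs0
  have hm0 : 0 < m := Nat.two_pow_pos a
  have hlva : lv ≤ a := by omega
  have hlFs : Fs.length = B * 2 ^ lv := NegFFT.length_twAt m (2 * m) B lv
  have hlF : (encVec Fs).length ≤ B * 2 ^ lv * (2 * (n + 1)) := by
    have hct : ∀ x ∈ Fs, x < 4 * m + 4 * m := fun F hF => by have := (NegFFT.twAt_facts a B lv hlva F hF).2.2; omega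
    have h8 : (encodeNat (4 * m + 4 * m)).length + 1 ≤ n + 1 := by
      rw [hm, show 4 * 2 ^ a + 4 * 2 ^ a = 2 ^ (a + 3) by rw [pow_add]; ring, encodeNat_two_pow]; simp; omega
    have := length_encVec_le_of_lt hct h8; rwa [hlFs] at this
  have hl : ∀ x, x ≤ 2 ^ (a + 2) → (encodeNat x).length ≤ n := fun x hx => (length_encodeNat_le_succ hx).trans (by omega)
  have hlk : (encodeNat k).length ≤ n := (length_encodeNat_le_succ (le_two_pow_self k)).trans (by omega)
  let v1 : GSlots := { w.descAt N k Fb Gb lv with fz := ⟨[], [], [], [], [], [], [], [], [], [], [], [], [], [], [], []⟩ }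
  let v2 : GSlots := { v1 with tw2 := [] }
  have h1 : Runs (clear (Sum.inr (rFG q .TW))) (base (gSt q T (w.descAt N k Fb Gb lv))) (base (gSt q T v1)) (2 * (B * 2 ^ lv * (2 * (n + 1))) + 1) := by
    refine (runs_clear (Sum.inr (rFG q .TW)) (base (gSt q T (w.descAt N k Fb Gb lv)))).of_eq (by simp [v1, GSlots.descAt, hfz]) ?_
    change 2 * (gSt q T (w.descAt N k Fb Gb lv) (rFG q .TW)).length + 1 ≤ _
    simp only [rFG_apply, gSt_sTW, GSlots.descAt, hfz, ← ha, ← hm, ← hB, ← hFs0]; omega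
  have h2 : Runs (clear (Sum.inr (q .TW2))) (base (gSt q T v1)) (base (gSt q T v2)) (2 * (B * 2 ^ lv * (2 * (n + 1))) + 1) := by
    refine (runs_clear (Sum.inr (q .TW2)) (base (gSt q T v1))).of_eq (by simp [v1, v2]) ?_
    change 2 * (gSt q T v1 (q .TW2)).length + 1 ≤ _
    simp only [gSt_TW2, v1, GSlots.descAt, ← ha, ← hm, ← hB, ← hFs0]; omega
  have h3 : Runs (NS.ofList [.clear (q (.f .HN)), .clear (q (.f .M2)), .clear (q (.f .M4)), .clear (q (.f (.n (.v .LEN)))), .clear (q .MREG),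
      .clear (q .TREG), .clear (q .LVN), .clear (q .KN), .succ (q .KN) (q .AR), .clear (q .AR)] : NS β).com
      (base (gSt q T v2)) (base (gSt q T (w.descEnd N k Fb Gb))) (99 * c) := by
    refine NS.runs_of_eq (N := n) _ _ ?_ ?_ (by simp [hc3])
    · simp only [NS.ofList, NS.ok, NOp.ok, NS.eval, NOp.eval, gSt_fHN, gSt_fM2, gSt_fM4, gSt_fvLEN, gSt_MREG, gSt_TREG, gSt_LVN, gSt_KN, gSt_AR,
        update_gSt_fHN, update_gSt_fM2, update_gSt_fM4, update_gSt_fvLEN, update_gSt_MREG, update_gSt_TREG, update_gSt_LVN, update_gSt_KN,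
        v2, v1, GSlots.descAt, ← ha, ← hlv, ← hm, Nat.sub_self, pow_zero, List.length_nil, hkn']
      refine ⟨hl 1 Nat.one_le_two_pow, hl _ ?_, hl _ ?_, hl _ ?_, hl _ ?_, hl _ ?_, hl _ ?_, ?_, ⟨hl _ ?_, by omega⟩, hl _ ?_, trivial⟩
      · rw [pow_add]; omega
      · rw [pow_add]; omega
      · rw [pow_add]; omega
      · rw [pow_add]; omega
      · exact (Nat.pow_le_pow_right (by norm_num) hlva).trans (by rw [pow_add]; omega)
      · exact (le_two_pow_self lv).trans ((Nat.pow_le_pow_right (by norm_num) hlva).trans (by rw [pow_add]; omega))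
      · exact hlk
      · exact (le_two_pow_self a).trans (by rw [pow_add]; omega)
      · exact (le_two_pow_self a).trans (by rw [pow_add]; omega)
    · have eL : NegFFT.dLevel N k Fb lv = NegFFT.descOne N k Fb := NegFFT.dLevel_last N k Fb
      have eG : NegFFT.dLevel N k Gb lv = NegFFT.descOne N k Gb := NegFFT.dLevel_last N k Gb
      simp [v2, v1, GSlots.descAt, GSlots.descEnd, hkd, har, hlvn, hlvu, hmreg, htreg, hhn, hm2, hm4, hlen, htw2, hfz, hkn', ← ha, ← hlv, eL, eG]
  refine (h1.seq (h2.seq h3)).of_eq rfl ?_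
  unfold descCCost; rw [← hlv]; omega

/-- **The descent step** at exponent `k ≥ 1`… any `k` (the driver runs it for `k ≥ 4`):
schedule, parameters, digits, the `⌊k/2⌋` forward levels, cleanup, next exponent. [folklore] -/
def descStep : Com (EReg ⊕ β) :=
  descA q ;; (countLoop (Sum.inr (q .LVU)) (lvBody q) ;; descC q)

/-- Cost of the descent step on `B` pairs of blocks at exponent `k`. [folklore] -/
def descStepCost (n k B : ℕ) : ℕ :=
  descACost n k B + ((k / 2) * (lvIterCost n (2 ^ ((k + 1) / 2)) (B * 2 ^ (k / 2 - 1)) + 2) + 1) + descCCost n k B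

/-- **The descent step.** [folklore] -/
theorem runs_descStep {N k n : ℕ} (hN : 0 < N) (hn : (encodeNat N).length + 1 ≤ n) (hkn : k + 4 ≤ n) (T : Regs β) (hI : DrvInv q N T)
    (w : GSlots) {Fb Gb : List (List ℕ)} (hFb : ∀ b ∈ Fb, NegFFT.BlockOK N (2 ^ k) b) (hGb : ∀ b ∈ Gb, NegFFT.BlockOK N (2 ^ k) b)
    (hBG : Gb.length = Fb.length)
    (hkn' : w.kn = encodeNat k) (hbf : w.bf = encBlocks Fb) (hbg : w.bg = encBlocks Gb)
    (hkd : w.kd = []) (har : w.ar = []) (hlvn : w.lvn = []) (hlvu : w.lvu = []) (hmreg : w.mreg = []) (htreg : w.treg = [])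
    (hhn : w.hn = []) (hm2 : w.m2 = []) (hm4 : w.m4 = []) (hlen : w.len = []) (htw2 : w.tw2 = []) (htws : w.tws = []) (htw3 : w.tw3 = [])
    (htmph : w.tmph = []) (hout : w.out = []) (htwout : w.twout = []) (hfz : w.fz = ⟨[], [], [], [], [], [], [], [], [], [], [], [], [], [], [], []⟩) :
    Runs (descStep q) (base (gSt q T w)) (base (gSt q T (w.descEnd N k Fb Gb))) (descStepCost n k Fb.length) := by
  set lv := k / 2 with hlv
  have hA := runs_descA q hn hkn T hI w hFb hGb hBG hkn' hbf hbg hkd har hlvn hlvu hmreg htreg hhn hm2 hm4 hlen htw2 htmph hout htwout hfz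
  -- the level loop
  have hloop := runs_countLoop (U := (Sum.inr (q .LVU) : EReg ⊕ β)) (body := lvBody q)
    (fun kc R => kc ≤ lv ∧ R = base (gSt q T (w.descAt N k Fb Gb (lv - kc)))) (lvIterCost n (2 ^ ((k + 1) / 2)) (Fb.length * 2 ^ (lv - 1)))
    (by
      rintro kc R ⟨hkc, rfl⟩ -
      have hr := runs_lvBody q hN hn hkn T hI w hFb hGb hBG htws htw3 htmph hout htwout hfz (j := lv - (kc + 1)) (by omega)
      have e1 : k / 2 - (lv - (kc + 1) + 1) = kc := by omega
      have e2 : lv - (kc + 1) + 1 = lv - kc := by omega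
      rw [e1, e2] at hr
      have e3 : Function.update (base (gSt q T (w.descAt N k Fb Gb (lv - (kc + 1))))) (Sum.inr (q .LVU)) (List.replicate kc true) =
          base (gSt q T { w.descAt N k Fb Gb (lv - (kc + 1)) with lvu := List.replicate kc true }) := by simp
      rw [e3]
      refine ⟨_, hr, ?_, by omega, rfl⟩
      simp only [nst_inr, gSt_LVU, GSlots.descAt]
      rw [show k / 2 - (lv - kc) = kc by omega])
    lv (base (gSt q T (w.descAt N k Fb Gb 0))) ⟨le_rfl, by rw [Nat.sub_self]⟩ (by simp [GSlots.descAt, ← hlv])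
  obtain ⟨R', hL, -, -, rfl⟩ := hloop
  rw [Nat.sub_zero] at hL
  have hC := runs_descC q (N := N) (Fb := Fb) (Gb := Gb) hkn T w hkn' hkd har hlvn hlvu hmreg htreg hhn hm2 hm4 hlen htw2 hfz
  refine (hA.seq (hL.seq hC)).of_eq rfl ?_
  unfold descStepCost; rw [← hlv]; omega

/-! ### The base step with its block length -/

/-- The leaves: `LEN := 2^k` from `KN`, the schoolbook products, cleanup. [folklore] -/
def baseAll : Com (EReg ⊕ β) :=
  pow2Into q (q (.f (.n (.v .LEN)))) (q .KN) ;; (baseStep q ;; (NS.ofList [.clear (q (.f (.n (.v .LEN)))), .clear (q .KN)] : NS β).com)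

/-- Cost of `baseAll` at leaf exponent `k` on `B` pairs. [folklore] -/
def baseAllCost (n k B : ℕ) : ℕ := n * (16 * k + 21) + 3 * k + 7 + baseStepCost n (2 ^ k) B + 6 * (n + 1) ^ 3

/-- **`baseAll`.** [folklore] -/
theorem runs_baseAll {N k n : ℕ} (hn : (encodeNat N).length + 1 ≤ n) (hkn : k + 2 ≤ n) (T : Regs β) (hI : DrvInv q N T)
    (w : GSlots) {Fb Gb : List (List ℕ)} (hFb : ∀ b ∈ Fb, NegFFT.BlockOK N (2 ^ k) b) (hGb : ∀ b ∈ Gb, NegFFT.BlockOK N (2 ^ k) b)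
    (hBG : Gb.length = Fb.length) (hkn' : w.kn = encodeNat k) (hbf : w.bf = encBlocks Fb) (hbg : w.bg = encBlocks Gb) (hrr : w.rr = [])
    (hlen : w.len = []) (hcc : w.cc = []) (hout : w.out = []) (hfz : w.fz = ⟨[], [], [], [], [], [], [], [], [], [], [], [], [], [], [], []⟩) :
    Runs (baseAll q) (base (gSt q T w))
      (base (gSt q T { w with kn := [], bf := [], bg := [], rr := encBlocks (List.zipWith (negMul N (2 ^ k)) Fb Gb) })) (baseAllCost n k Fb.length) := by
  have hgq : ∀ {i j : GReg}, i ≠ j → q i ≠ q j := fun h => gq_ne q h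
  have hU : T (q (.f (.n (.v .U)))) = [] := hI.2.2.2.2.2.2.2.2.2.2.1
  set c := (n + 1) ^ 3 with hc3
  have hlk : (encodeNat k).length ≤ n := (length_encodeNat_le_succ (le_two_pow_self k)).trans (by omega)
  have hLn : (encodeNat (2 ^ k)).length + 1 ≤ n := by rw [encodeNat_two_pow]; simp; omega
  let w1 : GSlots := { w with len := encodeNat (2 ^ k) }
  let w2 : GSlots := { w1 with bf := [], bg := [], rr := encBlocks (List.zipWith (negMul N (2 ^ k)) Fb Gb) }
  have h1 : Runs (pow2Into q (q (.f (.n (.v .LEN)))) (q .KN)) (base (gSt q T w)) (base (gSt q T w1)) (n * (16 * k + 21) + 3 * k + 7) := by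
    refine (runs_pow2Into q (hgq (by decide)) (hgq (by decide)) hlk (gSt q T w) (by simp [hkn']) (by simp [hlen])
      (by simp [gSt_v q T w, hU])).of_eq ?_ le_rfl
    simp [w1]
  have h2 : Runs (baseStep q) (base (gSt q T w1)) (base (gSt q T w2)) (baseStepCost n (2 ^ k) Fb.length) := by
    have h := runs_baseStep q hn hLn T hI w1 (fun f hf => hFb f hf) (fun g hg => hGb g hg) hBG.symm (by simp [w1, hbf]) (by simp [w1, hbg])
      (by simp [w1, hrr]) (by simp [w1]) (by simp [w1, hcc]) (by simp [w1, hout]) (by simp [w1, hfz])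
    exact h.of_eq (by simp only [w1, w2]) le_rfl
  have h3 : Runs (NS.ofList [.clear (q (.f (.n (.v .LEN)))), .clear (q .KN)] : NS β).com (base (gSt q T w2))
      (base (gSt q T { w with kn := [], bf := [], bg := [], rr := encBlocks (List.zipWith (negMul N (2 ^ k)) Fb Gb) })) (6 * c) := by
    refine NS.runs_of_eq (N := n) _ _ ?_ ?_ (by simp [hc3])
    · simp only [NS.ofList, NS.ok, NOp.ok, NS.eval, NOp.eval, gSt_fvLEN, gSt_KN, update_gSt_fvLEN, w2, w1, hkn']
      exact ⟨by omega, hlk, trivial⟩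
    · simp [w2, w1, hlen]
  refine (h1.seq (h2.seq h3)).of_eq rfl ?_
  unfold baseAllCost; omega

/-! ### The ascent step -/

/-- The driver record at merge height `r` of the ascent at exponent `k` (instances `B`, leaf
products `M`, remaining schedule `S`, ambient history `H`). [folklore] -/
def GSlots.ascAt (w : GSlots) (N k B : ℕ) (M : List (List ℕ)) (S H : List (List Bool)) (r : ℕ) : GSlots :=
  { w with sched := encList S, kn := encodeNat k, ar := encodeNat ((k + 1) / 2), lvn := encodeNat (k / 2), lvu := List.replicate (k / 2 - r) true, mreg := encodeNat (2 ^ ((k + 1) / 2)), treg := encodeNat (2 ^ (k / 2)), hn := encodeNat (2 ^ r), m2 := encodeNat (2 * 2 ^ ((k + 1) / 2)), m4 := encodeNat (4 * 2 ^ ((k + 1) / 2)), len := encodeNat (2 * 2 ^ ((k + 1) / 2)), cc := encodeNat (NegFFT.inv2N N), rr := encBlocks (NegFFT.aLevel N k B M r), hist := encList ((NegFFT.twHist (2 ^ ((k + 1) / 2)) (2 * 2 ^ ((k + 1) / 2)) B (k / 2 - r)).map encVec ++ H) }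

/-- The driver record after the ascent step. [folklore] -/
def GSlots.ascEnd (w : GSlots) (N k : ℕ) (M : List (List ℕ)) (S H : List (List Bool)) : GSlots :=
  { w with sched := encList S, kn := [], rr := encBlocks (NegFFT.ascOne N k M), hist := encList H }

/-- The first part of the ascent step: pop the exponent, set the parameters, load the inverse of
two, `HN := 1`. [folklore] -/
def ascA : Com (EReg ⊕ β) :=
  readItemTo (Sum.inr (q .SCHED)) (Sum.inr (q .KN)) (Sum.inr (rVG q .W)) (Sum.inr (rVG q .TT)) ;; (setParams q ;;
  (NS.ofList [.copy (q .CINV) (q (.f (.n (.v .C)))), .clear (q (.f .HN)), .push (q (.f .HN)) true] : NS β).com)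

/-- Cost of `ascA`. [folklore] -/
def ascACost (n k : ℕ) : ℕ := 11 * n + 9 + setParamsCost n k + 17 * (n + 1) ^ 3

/-- **`ascA`.** [folklore] -/
theorem runs_ascA {N k n B : ℕ} (hN1 : 1 < N) (hn : (encodeNat N).length + 1 ≤ n) (hkn : k + 4 ≤ n) (T : Regs β) (hI : DrvInv q N T)
    (hCI : T (q .CINV) = encodeNat (NegFFT.inv2N N)) (w : GSlots) {M : List (List ℕ)} (hM : M.length = B * 2 ^ (k / 2))
    {S H : List (List Bool)} (hsched : w.sched = encList (encodeNat k :: S)) (hrr : w.rr = encBlocks M)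
    (hhist : w.hist = encList ((NegFFT.twHist (2 ^ ((k + 1) / 2)) (2 * 2 ^ ((k + 1) / 2)) B (k / 2)).map encVec ++ H))
    (hkn' : w.kn = []) (hkd : w.kd = []) (har : w.ar = []) (hlvn : w.lvn = []) (hlvu : w.lvu = []) (hmreg : w.mreg = []) (htreg : w.treg = [])
    (hhn : w.hn = []) (hm2 : w.m2 = []) (hm4 : w.m4 = []) (hlen : w.len = []) (hcc : w.cc = []) :
    Runs (ascA q) (base (gSt q T w)) (base (gSt q T (w.ascAt N k B M S H 0))) (ascACost n k) := by
  have hgq : ∀ {i j : GReg}, i ≠ j → q i ≠ q j := fun h => gq_ne q h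
  have hW : T (q (.f (.n (.v .W)))) = [] := hI.2.2.2.2.2.2.1
  have hTT : T (q (.f (.n (.v .TT)))) = [] := hI.2.2.2.2.2.2.2.1
  set a := (k + 1) / 2 with ha
  set lv := k / 2 with hlv
  set m := 2 ^ a with hm
  set c := (n + 1) ^ 3 with hc3
  have hlk : (encodeNat k).length ≤ n := (length_encodeNat_le_succ (le_two_pow_self k)).trans (by omega)
  have hlm : (encodeNat m).length ≤ n := by rw [hm, encodeNat_two_pow]; simp; omega
  have hli : (encodeNat (NegFFT.inv2N N)).length ≤ n := (Brick.length_encodeNat_mono (NegFFT.inv2N_lt hN1).le).trans (by omega)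
  have e1 : encodeNat 1 = [true] := by simpa using encodeNat_two_pow 0
  let w1 : GSlots := { w with sched := encList S, kn := encodeNat k }
  let w2 : GSlots := w1.withParams k
  have h1 : Runs (readItemTo (Sum.inr (q .SCHED)) (Sum.inr (q .KN)) (Sum.inr (rVG q .W)) (Sum.inr (rVG q .TT))) (base (gSt q T w))
      (base (gSt q T w1)) (11 * n + 9) := by
    refine (runs_readItemTo (by simp [hgq]) (by simp [hgq]) (by simp [hgq]) (by simp [hgq]) (by simp [hgq]) (encodeNat k) (encList S)
      (base (gSt q T w)) (by simp [hsched, encList, boolPair, dbl]) (by simp [gSt_v q T w, hW]) (by simp [gSt_v q T w, hTT])).of_eq ?_ ?_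
    · simp [w1, hkn']
    · omega
  have h2 : Runs (setParams q) (base (gSt q T w1)) (base (gSt q T w2)) (setParamsCost n k) :=
    runs_setParams q (by omega) T hI w1 rfl (by simp [w1, hkd]) (by simp [w1, har]) (by simp [w1, hlvn]) (by simp [w1, hlvu])
      (by simp [w1, hmreg]) (by simp [w1, htreg]) (by simp [w1, hhn]) (by simp [w1, hm2]) (by simp [w1, hm4]) (by simp [w1, hlen])
  have h3 : Runs (NS.ofList [.copy (q .CINV) (q (.f (.n (.v .C)))), .clear (q (.f .HN)), .push (q (.f .HN)) true] : NS β).com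
      (base (gSt q T w2)) (base (gSt q T (w.ascAt N k B M S H 0))) (17 * c) := by
    refine NS.runs_of_eq (N := n) _ _ ?_ ?_ (by simp [hc3])
    · simp only [NS.ofList, NS.ok, NOp.ok, NS.eval, NOp.eval, gSt_CINV, gSt_fHN, gSt_fvC, update_gSt_fvC, w2, w1,
        GSlots.withParams, hCI, ← ha, ← hm, ne_eq, EmbeddingLike.apply_eq_iff_eq]
      exact ⟨⟨by decide, hli⟩, hlm, trivial, trivial⟩
    · have eM : M = NegFFT.aLevel N k B M 0 := (NegFFT.aLevel_zero N k B M hM).symm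
      simp [w2, w1, GSlots.withParams, GSlots.ascAt, hCI, hcc, hrr, hhist, ← ha, ← hlv, ← hm, e1, ← eM]
  refine (h1.seq (h2.seq h3)).of_eq rfl ?_
  unfold ascACost; omega

/-- One round of the inverse level loop: the inverse level pass (popping the parent twiddles from
`HIST`), then double `HN`. [folklore] -/
def ascBody : Com (EReg ⊕ β) :=
  lvlRR q ;; (NS.op (.push (q (.f .HN)) false) : NS β).com

/-- Cost of one round of the inverse level loop (`P = B · 2^{lv-1}`). [folklore] -/
def ascIterCost (n m P : ℕ) : ℕ := lvlBound (pairInvCost n m) n m P + (n + 1) ^ 3 + 12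

/-- **One round of the inverse level loop**, from merge height `r < lv` to `r + 1`. [folklore] -/
theorem runs_ascBody {N k n B : ℕ} (hN1 : 1 < N) (hn : (encodeNat N).length + 1 ≤ n) (hkn : k + 4 ≤ n) (T : Regs β) (hI : DrvInv q N T)
    (w : GSlots) {M : List (List ℕ)} (hM : M.length = B * 2 ^ (k / 2))
    (hMv : ∀ b ∈ M, b.length = 2 * 2 ^ ((k + 1) / 2) ∧ ∀ a ∈ b, a < N) (S H : List (List Bool))
    (hout : w.out = []) (htwout : w.twout = []) (hfz : w.fz = ⟨[], [], [], [], [], [], [], [], [], [], [], [], [], [], [], []⟩)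
    {r : ℕ} (hr : r < k / 2) :
    Runs (ascBody q) (base (gSt q T { w.ascAt N k B M S H r with lvu := List.replicate (k / 2 - (r + 1)) true }))
      (base (gSt q T (w.ascAt N k B M S H (r + 1)))) (ascIterCost n (2 ^ ((k + 1) / 2)) (B * 2 ^ (k / 2 - 1))) := by
  set a := (k + 1) / 2 with ha
  set lv := k / 2 with hlv
  set m := 2 ^ a with hm
  set c := (n + 1) ^ 3 with hc3
  set h := 2 ^ r with hh
  set Fs := NegFFT.twAt m (2 * m) B (lv - (r + 1)) with hFs0
  set Bs := NegFFT.aLevel N k B M r with hBs0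
  set nF := Fs.length with hnF
  have hm0 : 0 < m := Nat.two_pow_pos a
  have hN : 0 < N := by omega
  have hja : lv - (r + 1) < a := by omega
  have hFs : ∀ F ∈ Fs, F = 2 * (F / 2) ∧ 1 ≤ F / 2 ∧ F / 2 < 4 * m := NegFFT.twAt_hFs a B hja
  have hBs : ∀ b ∈ Bs, b.length = 2 * m ∧ ∀ x ∈ b, x < N := NegFFT.aLevel_valid N k B M hM hMv r hr.le
  have hlFs : nF = B * 2 ^ (lv - (r + 1)) := NegFFT.length_twAt m (2 * m) B _
  have h2h : 2 * h * 2 ^ (lv - (r + 1)) = 2 ^ lv := by rw [hh, ← pow_succ', ← pow_add]; congr 1; omega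
  have hP : h * nF = B * 2 ^ (lv - 1) := by
    rw [hlFs, hh, mul_left_comm, ← pow_add]; congr 2; omega
  have hlenB : Bs.length = 2 * h * nF := by
    rw [hBs0, NegFFT.length_aLevel N k B M hM hr.le, ← hlv, ← h2h, hlFs]; ring
  have hm4n : (encodeNat (4 * m)).length + 1 ≤ n := by
    rw [hm, show 4 * 2 ^ a = 2 ^ (a + 2) by rw [pow_add]; ring, encodeNat_two_pow]; simp; omega
  have hhn : (encodeNat h).length ≤ n := by rw [hh, encodeNat_two_pow]; simp; omega
  have hh1 : 1 ≤ h := Nat.one_le_two_pow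
  have eHN : encodeNat (2 ^ (r + 1)) = false :: encodeNat h := by rw [pow_succ, mul_comm]; exact encodeNat_two_mul _ (Nat.two_pow_pos _)
  have eHist : encList ((NegFFT.twHist m (2 * m) B (lv - r)).map encVec ++ H) = encList (encVec Fs :: ((NegFFT.twHist m (2 * m) B (lv - (r + 1))).map encVec ++ H)) := by
    rw [show lv - r = lv - (r + 1) + 1 by omega, NegFFT.twHist_succ, List.map_cons, List.cons_append]
  let v0 : GSlots := { w.ascAt N k B M S H r with lvu := List.replicate (lv - (r + 1)) true }
  let v1 : GSlots := { v0 with rr := encBlocks (levelOut (NegFFT.gI₁ N) (NegFFT.gI₂ N m) h Fs Bs), hist := encList ((NegFFT.twHist m (2 * m) B (lv - (r + 1))).map encVec ++ H) }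
  have h1 : Runs (lvlRR q) (base (gSt q T v0)) (base (gSt q T v1)) (lvlCost (pairInvCost n m) n m h nF + 20 * (nF * (n + 1)) + 12) := by
    have hq := runs_lvlRR q hN1 hn hm4n hhn T hI v0 (rest := (NegFFT.twHist m (2 * m) B (lv - (r + 1))).map encVec ++ H) hFs hBs hlenB
      (by simp [v0, GSlots.ascAt, hBs0]) (by simp [v0, GSlots.ascAt, ← ha, ← hm, ← hlv, eHist]) (by simp [v0, GSlots.ascAt, hh])
      (by simp [v0, GSlots.ascAt, ← ha, ← hm]) (by simp [v0, GSlots.ascAt, ← ha, ← hm]) (by simp [v0, GSlots.ascAt, ← ha, ← hm])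
      (by simp [v0, GSlots.ascAt]) (by simp [v0, GSlots.ascAt, hout]) (by simp [v0, GSlots.ascAt, htwout]) (by simp [v0, GSlots.ascAt, hfz])
    exact hq.of_eq (by simp only [v0, v1]) (by rw [hnF])
  have h2 : Runs (NS.op (.push (q (.f .HN)) false) : NS β).com (base (gSt q T v1)) (base (gSt q T (w.ascAt N k B M S H (r + 1)))) (1 * c) := by
    refine NS.runs_of_eq (N := n) _ _ (by simp [NOp.ok]) ?_ (by simp [hc3])
    have eBs : levelOut (NegFFT.gI₁ N) (NegFFT.gI₂ N m) h Fs Bs = NegFFT.aLevel N k B M (r + 1) := by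
      rw [hBs0, hFs0, hh, hm, hlv, ha]; exact NegFFT.levelOut_aLevel N k B M hr hM
    simp [v1, v0, GSlots.ascAt, ← ha, ← hlv, ← hm, ← hh, eHN, eBs]
  refine (h1.seq h2).of_eq rfl ?_
  have hb := lvlCost_le (pairInvCost n m) n m h nF hh1
  rw [hP] at hb
  unfold ascIterCost
  omega

/-- The last part of the ascent step: drop the inverse of two, `HN := m`, `T1 := t`, overlap-add,
cleanup. [folklore] -/
def ascC : Com (EReg ⊕ β) :=
  (NS.ofList [.clear (q (.f (.n (.v .C)))), .clear (q (.f .HN)), .copy (q .MREG) (q (.f .HN)), .copy (q .TREG) (q (.f .T1))] : NS β).com ;;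
  (oaRR q ;; (NS.ofList [.clear (q (.f .T1)), .clear (q (.f .HN)), .clear (q (.f .M2)), .clear (q (.f .M4)), .clear (q (.f (.n (.v .LEN)))),
    .clear (q .MREG), .clear (q .TREG), .clear (q .AR), .clear (q .LVN), .clear (q .KN)] : NS β).com)

/-- Cost of `ascC`. [folklore] -/
def ascCCost (n k B : ℕ) : ℕ := 62 * (n + 1) ^ 3 + oaRRCost n (2 ^ ((k + 1) / 2)) (2 ^ (k / 2)) B

/-- **`ascC`.** [folklore] -/
theorem runs_ascC {N k n B : ℕ} (hN1 : 1 < N) (hn : (encodeNat N).length + 1 ≤ n) (hkn : k + 4 ≤ n) (T : Regs β) (hI : DrvInv q N T)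
    (w : GSlots) {M : List (List ℕ)} (hM : M.length = B * 2 ^ (k / 2))
    (hMv : ∀ b ∈ M, b.length = 2 * 2 ^ ((k + 1) / 2) ∧ ∀ a ∈ b, a < N) (S H : List (List Bool))
    (hkd : w.kd = []) (har : w.ar = []) (hlvn : w.lvn = []) (hlvu : w.lvu = []) (hmreg : w.mreg = []) (htreg : w.treg = [])
    (hhn : w.hn = []) (hm2 : w.m2 = []) (hm4 : w.m4 = []) (hlen : w.len = []) (hcc : w.cc = [])
    (hout : w.out = []) (hfz : w.fz = ⟨[], [], [], [], [], [], [], [], [], [], [], [], [], [], [], []⟩) :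
    Runs (ascC q) (base (gSt q T (w.ascAt N k B M S H (k / 2)))) (base (gSt q T (w.ascEnd N k M S H))) (ascCCost n k B) := by
  have hgq : ∀ {i j : GReg}, i ≠ j → q i ≠ q j := fun h => gq_ne q h
  set a := (k + 1) / 2 with ha
  set lv := k / 2 with hlv
  set m := 2 ^ a with hm
  set t := 2 ^ lv with ht
  set c := (n + 1) ^ 3 with hc3
  have hm0 : 0 < m := Nat.two_pow_pos a
  have hlva : lv ≤ a := by omega
  have hl : ∀ x, x ≤ 2 ^ (a + 2) → (encodeNat x).length ≤ n := fun x hx => (length_encodeNat_le_succ hx).trans (by omega)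
  have hlk : (encodeNat k).length ≤ n := (length_encodeNat_le_succ (le_two_pow_self k)).trans (by omega)
  have hlm : (encodeNat m).length ≤ n := by rw [hm, encodeNat_two_pow]; simp; omega
  have hlt : (encodeNat t).length ≤ n := by rw [ht, encodeNat_two_pow]; simp; omega
  have hli : (encodeNat (NegFFT.inv2N N)).length ≤ n := (Brick.length_encodeNat_mono (NegFFT.inv2N_lt hN1).le).trans (by omega)
  obtain ⟨hfl, hlC, hC⟩ := NegFFT.aChunks_facts N k B M hM hMv
  set Cs := NegFFT.aChunks N k M with hCs0
  let v0 : GSlots := w.ascAt N k B M S H lv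
  let v1 : GSlots := { v0 with cc := [], hn := encodeNat m, fz := ⟨[], [], [], [], [], [], encodeNat t, [], [], [], [], [], [], [], [], []⟩ }
  let v2 : GSlots := { v1 with rr := encBlocks (Cs.map (NegFFT.overlapAdd N m)) }
  have h1 : Runs (NS.ofList [.clear (q (.f (.n (.v .C)))), .clear (q (.f .HN)), .copy (q .MREG) (q (.f .HN)), .copy (q .TREG) (q (.f .T1))] : NS β).com
      (base (gSt q T v0)) (base (gSt q T v1)) (32 * c) := by
    refine NS.runs_of_eq (N := n) _ _ ?_ ?_ (by simp [hc3])
    · simp only [NS.ofList, NS.ok, NOp.ok, NS.eval, NOp.eval, gSt_fvC, gSt_fHN, gSt_MREG, gSt_TREG, update_gSt_fvC, update_gSt_fHN, v0,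
        GSlots.ascAt, ← ha, ← hlv, ← hm, ← ht, Nat.sub_self, ne_eq, EmbeddingLike.apply_eq_iff_eq]
      exact ⟨hli, hlt, ⟨by decide, hlm⟩, ⟨by decide, hlt⟩, trivial⟩
    · simp [v0, v1, GSlots.ascAt, hfz, ← ha, ← hlv, ← hm, ← ht]
  have h2 : Runs (oaRR q) (base (gSt q T v1)) (base (gSt q T v2)) (oaRRCost n m t Cs.length) := by
    have hq := runs_oaRR q hn hlm hlt T hI v1 (Cs := Cs) (fun C hCm => hC C hCm) Nat.one_le_two_pow
      (by rw [hfl]; simp [v1, v0, GSlots.ascAt, ← hlv]) (by simp [v1]) (by simp [v1, v0, GSlots.ascAt, hout]) (by simp [v1])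
    exact hq.of_eq (by simp only [v1, v2]) le_rfl
  have h3 : Runs (NS.ofList [.clear (q (.f .T1)), .clear (q (.f .HN)), .clear (q (.f .M2)), .clear (q (.f .M4)), .clear (q (.f (.n (.v .LEN)))),
      .clear (q .MREG), .clear (q .TREG), .clear (q .AR), .clear (q .LVN), .clear (q .KN)] : NS β).com
      (base (gSt q T v2)) (base (gSt q T (w.ascEnd N k M S H))) (30 * c) := by
    refine NS.runs_of_eq (N := n) _ _ ?_ ?_ (by simp [hc3])
    · simp only [NS.ofList, NS.ok, NOp.ok, NS.eval, NOp.eval, gSt_sT1, gSt_fHN, gSt_fM2, gSt_fM4, gSt_fvLEN, gSt_MREG, gSt_TREG, gSt_AR, gSt_LVN, gSt_KN,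
        update_gSt_sT1, update_gSt_fHN, update_gSt_fM2, update_gSt_fM4, update_gSt_fvLEN, update_gSt_MREG, update_gSt_TREG, update_gSt_AR, update_gSt_LVN,
        v2, v1, v0, GSlots.ascAt, ← ha, ← hlv, ← hm, ← ht]
      refine ⟨hlt, hlm, hl _ ?_, hl _ ?_, hl _ ?_, hlm, hlt, hl _ ?_, hl _ ?_, hlk, trivial⟩
      · rw [pow_add]; omega
      · rw [pow_add]; omega
      · rw [pow_add]; omega
      · exact (le_two_pow_self a).trans (by rw [pow_add]; omega)
      · exact (le_two_pow_self lv).trans ((Nat.pow_le_pow_right (by norm_num) hlva).trans (by rw [pow_add]; omega))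
    · have eO : (NegFFT.aChunks N k M).map (NegFFT.overlapAdd N m) = NegFFT.ascOne N k M := NegFFT.map_overlapAdd_aChunks N k M
      simp [v2, v1, v0, GSlots.ascAt, GSlots.ascEnd, hkd, har, hlvn, hlvu, hmreg, htreg, hhn, hm2, hm4, hlen, hcc, hfz, ← ha, ← hlv, ← hm,
        hCs0, eO]
  refine (h1.seq (h2.seq h3)).of_eq rfl ?_
  unfold ascCCost; rw [hlC, ← ha, ← hlv, ← hm, ← ht]; omega

/-- **The ascent step**: pop the exponent, parameters, the `⌊k/2⌋` inverse levels, overlap-add,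
cleanup. [folklore] -/
def ascStep : Com (EReg ⊕ β) :=
  ascA q ;; (countLoop (Sum.inr (q .LVU)) (ascBody q) ;; ascC q)

/-- Cost of the ascent step at exponent `k` with `B` instances. [folklore] -/
def ascStepCost (n k B : ℕ) : ℕ :=
  ascACost n k + ((k / 2) * (ascIterCost n (2 ^ ((k + 1) / 2)) (B * 2 ^ (k / 2 - 1)) + 2) + 1) + ascCCost n k B

/-- **The ascent step.** [folklore] -/
theorem runs_ascStep {N k n B : ℕ} (hN1 : 1 < N) (hn : (encodeNat N).length + 1 ≤ n) (hkn : k + 4 ≤ n) (T : Regs β) (hI : DrvInv q N T)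
    (hCI : T (q .CINV) = encodeNat (NegFFT.inv2N N)) (w : GSlots) {M : List (List ℕ)} (hM : M.length = B * 2 ^ (k / 2))
    (hMv : ∀ b ∈ M, b.length = 2 * 2 ^ ((k + 1) / 2) ∧ ∀ a ∈ b, a < N) {S H : List (List Bool)}
    (hsched : w.sched = encList (encodeNat k :: S)) (hrr : w.rr = encBlocks M)
    (hhist : w.hist = encList ((NegFFT.twHist (2 ^ ((k + 1) / 2)) (2 * 2 ^ ((k + 1) / 2)) B (k / 2)).map encVec ++ H))
    (hkn' : w.kn = []) (hkd : w.kd = []) (har : w.ar = []) (hlvn : w.lvn = []) (hlvu : w.lvu = []) (hmreg : w.mreg = []) (htreg : w.treg = [])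
    (hhn : w.hn = []) (hm2 : w.m2 = []) (hm4 : w.m4 = []) (hlen : w.len = []) (hcc : w.cc = [])
    (hout : w.out = []) (htwout : w.twout = []) (hfz : w.fz = ⟨[], [], [], [], [], [], [], [], [], [], [], [], [], [], [], []⟩) :
    Runs (ascStep q) (base (gSt q T w)) (base (gSt q T (w.ascEnd N k M S H))) (ascStepCost n k B) := by
  set lv := k / 2 with hlv
  have hA := runs_ascA q hN1 hn hkn T hI hCI w hM hsched hrr hhist hkn' hkd har hlvn hlvu hmreg htreg hhn hm2 hm4 hlen hcc
  have hloop := runs_countLoop (U := (Sum.inr (q .LVU) : EReg ⊕ β)) (body := ascBody q)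
    (fun kc R => kc ≤ lv ∧ R = base (gSt q T (w.ascAt N k B M S H (lv - kc)))) (ascIterCost n (2 ^ ((k + 1) / 2)) (B * 2 ^ (lv - 1)))
    (by
      rintro kc R ⟨hkc, rfl⟩ -
      have hr := runs_ascBody q hN1 hn hkn T hI w hM hMv S H hout htwout hfz (r := lv - (kc + 1)) (by omega)
      have e1 : k / 2 - (lv - (kc + 1) + 1) = kc := by omega
      have e2 : lv - (kc + 1) + 1 = lv - kc := by omega
      rw [e1, e2] at hr
      have e3 : Function.update (base (gSt q T (w.ascAt N k B M S H (lv - (kc + 1))))) (Sum.inr (q .LVU)) (List.replicate kc true) =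
          base (gSt q T { w.ascAt N k B M S H (lv - (kc + 1)) with lvu := List.replicate kc true }) := by simp
      rw [e3]
      refine ⟨_, hr, ?_, by omega, rfl⟩
      simp only [nst_inr, gSt_LVU, GSlots.ascAt]
      rw [show k / 2 - (lv - kc) = kc by omega])
    lv (base (gSt q T (w.ascAt N k B M S H 0))) ⟨le_rfl, by rw [Nat.sub_self]⟩ (by simp [GSlots.ascAt, ← hlv])
  obtain ⟨R', hL, -, -, rfl⟩ := hloop
  rw [Nat.sub_zero] at hL
  have hC := runs_ascC q hN1 hn hkn T hI w hM hMv S H hkd har hlvn hlvu hmreg htreg hhn hm2 hm4 hlen hcc hout hfz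
  refine (hA.seq (hL.seq hC)).of_eq rfl ?_
  unfold ascStepCost; rw [← hlv]; omega


end Com

end Literature.Computability.Complexity
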